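import Summits.QuantumFields.YangMills.Theses.LangevinControlUV
import Summits.QuantumFields.YangMills.Theorems.HypercubicLimit.Negative.AllTimesGapFalse
import Literature.MathematicalPhysics.QuantumFieldTheory.LatticeGaugeProofs
import Literature.MathematicalPhysics.QuantumLattice.GaugeGroupsProofs

/-!
# Disproof of `LatticeGapInUVUnits` — standing adversary work file (cdisprove, gen 1 v5 + gen 2 v7)

Crux item `stmt-QuantumFields-9366` = `Summit.QuantumFields.YangMills.Theses.LangevinControlUV.LatticeGapInUVUnits`
(rank 5, the IMPORTED infrared leg of route `LangevinControlUV`): for every compact simple `G`, faithful unitary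
`r` and EVERY unit map `a : ℝ → ℝ` carrying the femto two-point package of `FemtoCurvatureTwoPoint`
(`Package r a` below), all pairs of gauge-invariant local lattice observables cluster exponentially, uniformly in
the volume, at rate `c₁ · a(β)` per lattice step for all `β ≥ β₂` (`Concl r a`): "the lattice mass gap is `≥ c₁`
in the units `a`", i.e. `ξ(β) · a(β) = O(1)`.

## Findings (everything below the docblock is checked and sorry-free; there are no near-misses/sorries)

LANDED in the tree (prover/ideator-importable, `--supports stmt-QuantumFields-9366`, namespace
`Summit.QuantumFields.YangMills.Theorems.LatticeGapInUVUnits.Negative`):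
* `Theorems/LatticeGapInUVUnits/Negative/WeakCouplingConcentration.lean` — p73970, commit b817a1ec246e (§6 on the
  tree's `plaquetteCost`: `wilsonMeasure_real_action_ge_le`, `tendsto_wilsonExpectation_plaquetteCost`,
  `tendsto_cov_plaquetteCost`, `shape_tendsto_zero_of_femto_lower_bound`, `not_femto_lower_bound_of_subsingleton`, …);
* `Theorems/LatticeGapInUVUnits/Negative/UniformConstantFalse.lean` — p74453, commit 2d034d6e0a8d (§7:
  `latticeConnectedCorr_smul`, `not_uniform_constant_clustering`, `not_uniform_constant_clustering_of_simple`).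

GEN 2 (cycle 2, 2026-08-16) — NEW: **the instance blocker is gone** (`isSimpleCompactGroup_specialUnitaryGroup_holds`
is a tree THEOREM now, so `IsCompactSimpleLieGroup SU(N)`, `N ≥ 2`, holds unconditionally: §10 `isCompactSimpleLieGroup_su`,
`not_crux_of_su_witness`), hence `¬crux` needs EXACTLY two open physics inputs, and the whole reduction is now a
kernel-checked NEGATIVE LEMMA MODULO H (files `Negative/SlowRulers.lean` — pure Mathlib: generic rulers +
`exists_slow_ruler`, proposal p76388 — and `Negative/LatticeGapInUVUnitsFalseOfStandardScalingSU.lean` — gauge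
instantiation `exists_slow_package`, the @[conjecture] nodes and the lemma, `--negative-modulo StandardScalingSU`;
rc 0, sorry-free, ≈ 610 lines; §10 restates the interface):
  `latticeGapInUVUnits_false_of_standardScalingSU : StandardScalingSU → ¬ LatticeGapInUVUnits`,
  `StandardScalingSU := ∃ N ≥ 2, FixedTorusTwoSided (suFund N) ∧ XiDiverges (suFund N)` (@[conjecture] nodes), where
  * `FixedTorusTwoSided r` (H_UV, finite-dimensional): `∃ 0 < c₀, C₀, ∀ L, ∃ B(L), ∀ β ≥ B(L)`: axis two-sided
    `c₀ ≤ β² n⁸ Cov_{β,L}(P_0^{01}, P_{ne₂}^{01}) ≤ C₀` (`1 ≤ n ≤ L/8`) and all pairs `β² |Cov| dist⁸ ≤ C₀` — fixed-torus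
    `β → ∞` Gaussian asymptotics with `L`-uniform LIMITING constants, thresholds arbitrary (Lüscher 1983, Coste et al. 1985;
    = C⁺ of card generic-step-gamma-encoding@9363, triage pass); NO multiscale / cutoff-uniform content;
  * `XiUnbounded r` (H_IR, WEAK form): `∃ A B, ∀ ε > 0, ∀ b, ∃ β ≥ b, ∀ S₀ C, ∃ S ≥ S₀, n ≤ S, C e^{−ε n} < |corr_{β,2S+1}(A,B,n)|`
    — along SOME sequence `β_j → ∞` the clustering rate of some pair on large tori tends to `0`, i.e. `limsup ξ(β) = ∞`
    (implied by `ξ(β) → ∞`, Chatterjee 1803.01950 Problem 5.1; open). (§10's `XiDivergesD` is the stronger `∀ β` form.)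
  The UV half no longer asks for "cutoff-uniform femto bounds" (gen-1's reading of the disproof burden was too
  pessimistic): `exists_slow_package` CONSTRUCTS, from fixed-torus asymptotics alone, above ANY `ω → 0`, an admissible
  unit map (dyadic step ruler `a = u_k` on `[2^k, 2^{k+1})`, generic values `u_k² = t_k √p_k` so that the femto grids
  `{√m u_k}` of different steps never collide — irrationality of `√(p_k p_j)` —, `Γ := 4^{-k}` on the `k`-th grid, `1`
  elsewhere, thresholds by `Nat.findGreatest`, `c = c₀/4`, `C = C₀`, `ℓ₀ = 1`) with `a(2^k) ≥ ω(2^k)`; with `ω = √m` the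
  crux's rate `c₁ a ≥ c₁ √m ≥ m` contradicts the IR lower bound at a large dyadic coupling on a large torus.
  Classification when H is discharged: `refuted-misstated`, C′ = `Continuous a` (or `MonotoneOn Γ (Set.Ioc 0 ℓ₀)`), unchanged.

VERDICT SO FAR: **no formal kill; MISSTATED ON PAPER (planner concurs in the item's own "why it might fail"),
irreparable by a Lean refutation today.** Classification if a kill ever lands: `refuted-misstated`, repaired
statement C′ = the crux with `Continuous a` (or `Continuous a ∧ Antitone a`) added to the hypothesis on the unit
map (Lean: insert `Continuous a ∧` in front of `(∃ (Γ : ℝ → ℝ) (β₀ ℓ₀ c C : ℝ), …)`); the paper witness below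
misses C′.

* §0 `crux_iff` — the crux is literally `∀ G r a, Package r a → Concl r a` (definitional); `Package`,
  `PackageWith`, `BoxBounds`, `Concl`, `ConclRate` name its parts (the SAME package is the hypothesis of
  `FemtoCurvatureSkewness` and `OSLegsFromFemtoAndGap`, and the body of `FemtoCurvatureTwoPoint`).
* §1 (proved; the a-priori bound |corr| ≤ 2 C_A C_B is the tree's `HypercubicLimit.Negative.abs_latticeConnectedCorr_le`) `conclRate_zero` (with rate constant
  `c₁ = 0` the conclusion holds OUTRIGHT: `0 < c₁` carries all the content), `conclRate_anti`,
  `concl_of_eventually_le` (the conclusion only WEAKENS along eventual minorants of `a`), `concl_of_eventuallyEq`.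
* §2 (proved) SCALE COVARIANCE: `packageWith_smul`, `package_smul_iff`, `concl_smul_iff` — `a ↦ t·a` (`t > 0`) is
  invisible to hypothesis and conclusion; `c₁` is not intrinsic.
* §3 (proved) JUNK GROUP: `not_package_of_subsingleton` — for a trivial gauge group every plaquette covariance
  vanishes, the two-sided axis bound fails in the box `L = 8`, the package is unsatisfiable and the crux holds
  vacuously (`crux_at_subsingleton`): deleting `IsCompactSimpleLieGroup` opens no junk refutation.
* §4 (proved) `a(β) → 0` IS LOAD-BEARING AGAINST VACUITY: `packageWithoutTendsto_const_two` (the constant unit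
  map `a ≡ 2`, `ℓ₀ = 1` has NO femto box, so the package minus `Tendsto` holds for lack of boxes) and
  `uniformLatticeUnitGap_of_cruxWithoutTendsto` (the crux minus `Tendsto` implies a `β`-uniform gap in LATTICE
  units at weak coupling — physically absurd, formally open).
* §5 (proved) GERM: `package_of_eventuallyEq` — only the tail of `a` matters (push `β₀` up).
* §6 (proved) WEAK-COUPLING CONCENTRATION on a fixed torus: `wilsonMeasure_real_action_ge_le`
  (`μ_{β,L}{S ≥ ε} ≤ e^{−βε/2}/p(ε)`, Laplace principle: `S ≥ 0` continuous, `S(1) = 0`, product Haar charges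
  open sets), `tendsto_wilsonExpectation_plaq` (`E_{β,L}[P] → 0`), `tendsto_cov_plaq` (`Cov_{β,L}(P, P') → 0` as
  `β → ∞` at fixed `L`); hence TIGHTNESS of the hypothesis `0 < Γ`: `packageWith_shape_tendsto_zero` — for EVERY
  package `Γ(a(β)) → 0` (box `L = 8`, `n = 1`: `c Γ(a(β)) ≤ Cov → 0`), `not_packageWith_of_shape_ge` (no package has
  `inf Γ > 0`), `packageWith_c_le_C`. The "asymptotic-freedom dividend" the planner left untyped is forced on the
  grid `s = a(β)` by concentration alone.
* §7 (proved) A NATURAL STRENGTHENING THAT IS FALSE: `not_conclUniformC` / `not_conclUniformC_of_simple` — the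
  conclusion with ONE constant `C` for all pairs `(A, B)` (`∃ C ∀ A B`) fails for every non-abelian compact `G`,
  every `r`, every `a` (scale the curvature observable: `corr(tP, tP, 0) = t² Var_β(P)` with `Var_β(P) > 0` by the
  tree's `variance_pos` / `actionDensity_ne`); the quantifier order `∀ A B, ∃ C` is load-bearing.
* §9 (proved) `hasLatticeMassGap_of_concl` (the socket: `Concl` IS `HasLatticeMassGap` at rate `c₁` along every
  scheme in units `a`) and `CruxRepaired` (C′, Lean signature of the repair) with `cruxRepaired_of_crux`.
* §10 (gen 2, proved) `isCompactSimpleLieGroup_su` (SU(N) instance, unconditional), `not_crux_of_su_witness`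
  (refutation template with a real group), `FixedTorusTwoSidedD` / `XiDivergesD` (the two open inputs, restated),
  `not_concl_of_xiDiverges_of_slow` (IR bookkeeping of the negative lemma).
* §11 (gen 2, proved) `ruler_lt_of_continuous`, `level_attained_of_continuous` — under the repair C′ (`Continuous a`) and only the UPPER fixed-torus
  `β⁻²` bounds, admissible rulers satisfy `a(β) < s/n` whenever the torus `8n` is beyond its threshold at `β`: the slow
  rulers of §10 are impossible under C′ for a provable reason (dimensional transmutation is forced into the package).
* §8 (paper, this docblock) REGIMES TRIED, all dead for a FORMAL kill: `β ≡ 0` / small `β` (irrelevant: `β ≥ β₂`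
  existential); trivial / finite / abelian `G` (excluded, or package unsatisfiable §3); `a ≡ const` (needs the
  deleted `Tendsto`, §4); `a ≤ 0` somewhere (excluded by `0 < a β`; with it deleted, `Γ` off `(0, ℓ₀]` is free but
  `n` is unbounded at fixed `n·a(β)`, so no vacuity); fast-decaying `a` (conclusion WEAKER, §1
  `concl_of_eventually_le`); slow step maps (the paper kill above — package unverifiable in Lean); `Γ` bounded
  below (impossible, §6); uniform-in-`(A,B)` constant `C` (false, §7).

WHY NO LEAN KILL (disproof burden): `¬crux` needs SOME `(G, r, a)` with `Package r a` TRUE — i.e. two-sided,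
cutoff-uniform bounds on dimension-8 plaquette covariances in femto boxes, the open UV statement of crux
`FemtoCurvatureTwoPoint` (for junk `a` as much as for the physical one: the LOWER bound `c Γ ≤ n⁸ Cov` is a
positivity-and-size statement about 4D non-abelian lattice Yang–Mills at weak coupling that no printed theorem
gives) — AND `Concl r a` FALSE, i.e. a quantitative LOWER bound on truncated correlations at separations
`n ≫ 1/a(β)` in large volume at large `β` (at least `ξ(β) → ∞`, Chatterjee arXiv:1803.01950 Problem 5.1, tree
`Literature.MathematicalPhysics.QuantumFieldTheory.LatticeMassGapAllCouplings`, registered OPEN). Both halves are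
open; neither has a finite/decidable model (the gauge group must be compact, connected, non-abelian).
GEN-2 CORRECTION: the UV half is WEAKER than stated here — fixed-torus two-sided `β⁻²` asymptotics with `L`-uniform
constants (`FixedTorusTwoSided`, no cutoff-uniformity, thresholds arbitrary) already yield admissible slow rulers
(`exists_slow_package`, proved); and the compact simple instance `SU(N)` is available. What remains open is exactly
`FixedTorusTwoSided ∧ XiDiverges` for one `SU(N)` (§10).

THE PAPER KILL (why the statement is nevertheless misstated). `∀ a` ranges over STEP unit maps decaying as slowly
as one likes, e.g. `a(β) = a_k` on `[2^k, 2^{k+1})` with `a_k ↓ 0` slowly and the grids `{n a_k : n ≤ ℓ₀/(8a_k)}`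
pairwise disjoint. RG-improved femto perturbation theory (Lüscher 1983, Coste et al. 1985; one-loop running with
`Σ g_j⁴ < ∞`) gives `n⁸ Cov_{β,L}(P₀, P_{ne₂}) ≍ g_R(n a_phys(β))⁴` in every box `L ≤ ℓ₀/a(β) ≪ 1/a_phys(β)`, a
quantity varying by bounded factors over each plateau (`β ∈ [2^k, 2^{k+1})`, `log n ≤ (1−δ) β/(8b₀)`), so a
plateau-wise defined `Γ` carries the package: `Package r a` is (physically) TRUE for such junk `a`. But then
`Concl r a` says `ξ(β) ≤ 1/(c₁ a(β))`, e.g. `ξ(β) = O(log β)`, against asymptotic scaling `ξ(β) ≍ e^{β/(8b₀)}`: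
(physically) FALSE. For CONTINUOUS `a` the same perturbative input pins `a ≍ a_phys` (every level `s = n a(β)` is
met at unboundedly many `β`, forcing `g_R(s · a_phys(β)/a(β))⁴ ≍ Γ(s)`, hence `a_phys/a` bounded above and below),
and the crux becomes the honest "mass gap ≥ c₁ Λ" — Clay-hard, believed true. Hence C′ above.

PROVER NOTE. Inside the route the crux is only ever applied (theorem `closes`) to the unit map produced by
`FemtoCurvatureTwoPoint`; a planner can therefore restrict BOTH items to continuous (monotone) unit maps at no
cost to the assembly, which removes the junk without touching the mechanism.
-/

namespace Summit.QuantumFields.YangMills.Cruxes.LatticeGapInUVUnits.Disproof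

open Filter Topology MeasureTheory
open Literature.MathematicalPhysics.QuantumFieldTheory Literature.MathematicalPhysics.QuantumLattice
open Summit.QuantumFields.YangMills.Theses.LangevinControlUV
open Summit.QuantumFields.YangMills.Theorems.HypercubicLimit.Negative
  (abs_latticeConnectedCorr_le variance_pos actionDensity_ne torusLift_dirConfigT torusLift_one
    latticeConnectedCorr_zero_time)

noncomputable section

/-! ## §0 The crux, uncurried: `Package → Concl` -/

section Anatomy

variable {G : Type} [Group G] [TopologicalSpace G] [IsTopologicalGroup G] [CompactSpace G]
  [MeasurableSpace G] [BorelSpace G]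

/-- The femto two-point bounds in ONE periodic box `(ℤ/L)⁴` at coupling `β`, for the unit map `a`, shape function
`Γ` and constants `c, C` (verbatim the `let`-body shared by the four cruxes `FemtoCurvatureTwoPoint`,
`FemtoCurvatureSkewness`, `LatticeGapInUVUnits`, `OSLegsFromFemtoAndGap` of route `LangevinControlUV`). [folklore] -/
def BoxBounds (r : LatticeRep G) (a Γ : ℝ → ℝ) (c C : ℝ) (L : ℕ) [NeZero L] (β : ℝ) : Prop :=
  let P : (Fin 4 → ZMod L) → Fin 4 → Fin 4 → GaugeConfig 4 L G → ℝ :=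
    fun x i j U => (r.N : ℝ) - (r.ρ (plaquetteHolonomy U x i j)).trace.re
  let E : (GaugeConfig 4 L G → ℝ) → ℝ := fun F => wilsonExpectation (d := 4) (L := L) r.ρ β F
  let cov : (GaugeConfig 4 L G → ℝ) → (GaugeConfig 4 L G → ℝ) → ℝ :=
    fun F F' => E (fun U => F U * F' U) - E F * E F'
  let dist : (Fin 4 → ZMod L) → (Fin 4 → ZMod L) → ℝ :=
    fun x y => Real.sqrt (∑ k : Fin 4, (((x k - y k).valMinAbs : ℤ) : ℝ) ^ 2)
  (∀ n : ℕ, 1 ≤ n → 8 * n ≤ L →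
      c * Γ ((n : ℝ) * a β) ≤ (n : ℝ) ^ 8 * cov (P 0 0 1) (P (Pi.single (2 : Fin 4) ((n : ℕ) : ZMod L)) 0 1) ∧
        (n : ℝ) ^ 8 * cov (P 0 0 1) (P (Pi.single (2 : Fin 4) ((n : ℕ) : ZMod L)) 0 1) ≤ C * Γ ((n : ℝ) * a β)) ∧
    (∀ (x y : Fin 4 → ZMod L) (i j i' j' : Fin 4), x ≠ y → i ≠ j → i' ≠ j' →
      |cov (P x i j) (P y i' j')| * dist x y ^ 8 ≤ C * Γ (dist x y * a β))

/-- The femto two-point PACKAGE of the unit map `a` with explicit witnesses `(Γ, β₀, ℓ₀, c, C)`. [folklore] -/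
def PackageWith (r : LatticeRep G) (a Γ : ℝ → ℝ) (β₀ ℓ₀ c C : ℝ) : Prop :=
  0 < ℓ₀ ∧ 0 < c ∧ (∀ β, 0 < a β) ∧ Tendsto a atTop (𝓝 0) ∧
    (∀ s : ℝ, 0 < s → s ≤ ℓ₀ → 0 < Γ s ∧ Γ s ≤ 1) ∧
      ∀ (L : ℕ) [NeZero L] (β : ℝ), β₀ ≤ β → (L : ℝ) * a β ≤ ℓ₀ → BoxBounds r a Γ c C L β

/-- The hypothesis of the crux on the unit map `a`: the femto two-point package (= the body of
`FemtoCurvatureTwoPoint` after its `∃ a`). [folklore] -/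
def Package (r : LatticeRep G) (a : ℝ → ℝ) : Prop :=
  ∃ (Γ : ℝ → ℝ) (β₀ ℓ₀ c C : ℝ), PackageWith r a Γ β₀ ℓ₀ c C

/-- The conclusion of the crux at a prescribed rate constant `c₁` (no sign condition): volume-uniform exponential
clustering of all pairs of gauge-invariant local observables at rate `c₁ · a(β)` per lattice step, for `β ≥ β₂`,
on all tori of side `2S + 1 ≥ 2 S₁(β) + 1`, time separations `n ≤ S`. [folklore] -/
def ConclRate (r : LatticeRep G) (a : ℝ → ℝ) (c₁ : ℝ) : Prop :=
  ∃ (β₂ : ℝ) (S₁ : ℝ → ℕ), ∀ A B : YMSpecies G, ∃ C : ℝ, ∀ β : ℝ, β₂ ≤ β → ∀ S n : ℕ, S₁ β ≤ S → n ≤ S →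
    |latticeConnectedCorr r.ρ β (2 * S + 1) A.F B.F n| ≤ C * Real.exp (-(c₁ * a β * n))

/-- The conclusion of the crux: clustering at SOME positive rate constant `c₁` in the units `a`. [folklore] -/
def Concl (r : LatticeRep G) (a : ℝ → ℝ) : Prop :=
  ∃ (c₁ β₂ : ℝ) (S₁ : ℝ → ℕ), 0 < c₁ ∧ ∀ A B : YMSpecies G, ∃ C : ℝ, ∀ β : ℝ, β₂ ≤ β → ∀ S n : ℕ,
    S₁ β ≤ S → n ≤ S → |latticeConnectedCorr r.ρ β (2 * S + 1) A.F B.F n| ≤ C * Real.exp (-(c₁ * a β * n))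

/-- `Concl` is `∃ c₁ > 0, ConclRate c₁`. [folklore] -/
theorem concl_iff_exists_rate (r : LatticeRep G) (a : ℝ → ℝ) :
    Concl r a ↔ ∃ c₁ : ℝ, 0 < c₁ ∧ ConclRate r a c₁ := by
  constructor
  · rintro ⟨c₁, β₂, S₁, hc, h⟩
    exact ⟨c₁, hc, β₂, S₁, h⟩
  · rintro ⟨c₁, hc, β₂, S₁, h⟩
    exact ⟨c₁, β₂, S₁, hc, h⟩

end Anatomy

/-- **The crux uncurried.** `LatticeGapInUVUnits` is literally `∀ G (compact simple) r a, Package r a → Concl r a`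
(definitional unfolding; the Borel σ-algebra is supplied inside as in the route file). [folklore] -/
theorem crux_iff :
    LatticeGapInUVUnits ↔
      ∀ (G : Type) [Group G] [TopologicalSpace G] [IsTopologicalGroup G] [CompactSpace G],
        IsCompactSimpleLieGroup G →
          letI : MeasurableSpace G := borel G
          haveI : BorelSpace G := ⟨rfl⟩
          ∀ (r : LatticeRep G) (a : ℝ → ℝ), Package r a → Concl r a := by
  constructor
  · intro h G _ _ _ _ hG r a hP
    obtain ⟨Γ, β₀, ℓ₀, c, C, hℓ, hc, hpos, hlim, hΓ, hbox⟩ := hP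
    exact h G hG r a ⟨Γ, β₀, ℓ₀, c, C, hℓ, hc, hpos, hlim, hΓ, fun L _ β h₁ h₂ => hbox L β h₁ h₂⟩
  · intro h G _ _ _ _ hG r a hP
    obtain ⟨Γ, β₀, ℓ₀, c, C, hℓ, hc, hpos, hlim, hΓ, hbox⟩ := hP
    exact h G hG r a ⟨Γ, β₀, ℓ₀, c, C, hℓ, hc, hpos, hlim, hΓ, fun L _ β h₁ h₂ => hbox L β h₁ h₂⟩

/-! ## §1 A priori bounds; the rate constant `c₁ > 0` carries all the content -/

section Rates

variable {G : Type} [Group G] [TopologicalSpace G] [IsTopologicalGroup G] [CompactSpace G]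
  [MeasurableSpace G] [BorelSpace G]

-- `abs_latticeConnectedCorr_le` (|corr| ≤ 2 C_A C_B at every coupling, volume and separation) is the tree's
-- `Summit.QuantumFields.YangMills.Theorems.HypercubicLimit.Negative.abs_latticeConnectedCorr_le`.

/-- **`0 < c₁` is load-bearing (and carries ALL the content).** With rate constant `c₁ = 0` the conclusion of the
crux holds outright, for every `G, r` and every unit map: the bound is the a-priori bound `2 C_A C_B`. [folklore] -/
theorem conclRate_zero (r : LatticeRep G) (a : ℝ → ℝ) : ConclRate r a 0 := by
  refine ⟨0, fun _ => 0, fun A B => ?_⟩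
  obtain ⟨CA, hCA⟩ := A.bounded
  obtain ⟨CB, hCB⟩ := B.bounded
  refine ⟨2 * (CA * CB), fun β _ S n _ _ => ?_⟩
  simpa using abs_latticeConnectedCorr_le r β (2 * S + 1) hCA hCB n

/-- The conclusion at rate `c₁` is antitone in `c₁` (nonnegative unit map). [folklore] -/
theorem conclRate_anti (r : LatticeRep G) {a : ℝ → ℝ} (ha : ∀ β, 0 ≤ a β) {c₁ c₁' : ℝ} (hc : c₁' ≤ c₁)
    (h : ConclRate r a c₁) : ConclRate r a c₁' := by
  obtain ⟨β₂, S₁, h⟩ := h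
  refine ⟨β₂, S₁, fun A B => ?_⟩
  obtain ⟨C, hC⟩ := h A B
  refine ⟨max C 0, fun β hβ S n hS hn => (hC β hβ S n hS hn).trans ?_⟩
  have hn0 : (0 : ℝ) ≤ n := Nat.cast_nonneg n
  have key : c₁' * a β * n ≤ c₁ * a β * n :=
    mul_le_mul_of_nonneg_right (mul_le_mul_of_nonneg_right hc (ha β)) hn0
  calc C * Real.exp (-(c₁ * a β * n)) ≤ max C 0 * Real.exp (-(c₁ * a β * n)) :=
        mul_le_mul_of_nonneg_right (le_max_left _ _) (Real.exp_pos _).le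
    _ ≤ max C 0 * Real.exp (-(c₁' * a β * n)) :=
        mul_le_mul_of_nonneg_left (Real.exp_le_exp.2 (neg_le_neg key)) (le_max_right _ _)

/-- **The conclusion only weakens along eventual minorants of the unit map**: if all pairs cluster at rate
`c₁ a(β)` and `b ≤ a` eventually, they cluster at rate `c₁ b(β)` (push `β₂` up). So among all unit maps carrying
the femto package, the crux is most demanding for the SLOWEST-decaying ones (§5). [folklore] -/
theorem concl_of_eventually_le (r : LatticeRep G) {a b : ℝ → ℝ} (h : Concl r a)
    (hba : ∀ᶠ β in atTop, b β ≤ a β) : Concl r b := by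
  obtain ⟨c₁, β₂, S₁, hc, h⟩ := h
  obtain ⟨βs, hβs⟩ := eventually_atTop.1 hba
  refine ⟨c₁, max β₂ βs, S₁, hc, fun A B => ?_⟩
  obtain ⟨C, hC⟩ := h A B
  refine ⟨max C 0, fun β hβ S n hS hn => ?_⟩
  have hβ₂ : β₂ ≤ β := (le_max_left _ _).trans hβ
  have hle : b β ≤ a β := hβs β ((le_max_right _ _).trans hβ)
  refine (hC β hβ₂ S n hS hn).trans ?_
  have hn0 : (0 : ℝ) ≤ n := Nat.cast_nonneg n
  have key : c₁ * b β * n ≤ c₁ * a β * n :=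
    mul_le_mul_of_nonneg_right (mul_le_mul_of_nonneg_left hle hc.le) hn0
  calc C * Real.exp (-(c₁ * a β * n)) ≤ max C 0 * Real.exp (-(c₁ * a β * n)) :=
        mul_le_mul_of_nonneg_right (le_max_left _ _) (Real.exp_pos _).le
    _ ≤ max C 0 * Real.exp (-(c₁ * b β * n)) :=
        mul_le_mul_of_nonneg_left (Real.exp_le_exp.2 (neg_le_neg key)) (le_max_right _ _)

/-- Only the germ of the unit map at `β = +∞` matters for the conclusion. [folklore] -/
theorem concl_of_eventuallyEq (r : LatticeRep G) {a b : ℝ → ℝ} (h : Concl r a)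
    (hba : ∀ᶠ β in atTop, b β = a β) : Concl r b :=
  concl_of_eventually_le r h (hba.mono fun _ h => h.le)

end Rates

/-! ## §2 Scale covariance: the package and the conclusion cannot see `a ↦ t · a` -/

section Scale

variable {G : Type} [Group G] [TopologicalSpace G] [IsTopologicalGroup G] [CompactSpace G]
  [MeasurableSpace G] [BorelSpace G]

/-- Rescaling the unit map by `t ≠ 0` and the shape function by `s ↦ Γ(s/t)` leaves every box bound unchanged.
[folklore] -/
theorem boxBounds_smul_iff (r : LatticeRep G) (a Γ : ℝ → ℝ) (c C : ℝ) (L : ℕ) [NeZero L] (β : ℝ)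
    {t : ℝ} (ht : t ≠ 0) :
    BoxBounds r (fun β => t * a β) (fun s => Γ (s / t)) c C L β ↔ BoxBounds r a Γ c C L β := by
  have key : ∀ x : ℝ, x * (t * a β) / t = x * a β := fun x => by field_simp
  simp only [BoxBounds, key]

/-- **Scale covariance of the package**: `PackageWith a Γ β₀ ℓ₀ c C → PackageWith (t a) Γ(·/t) β₀ (t ℓ₀) c C`
for every `t > 0`. The femto package pins NO absolute scale of `a`. [folklore] -/
theorem packageWith_smul (r : LatticeRep G) {a Γ : ℝ → ℝ} {β₀ ℓ₀ c C : ℝ}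
    (h : PackageWith r a Γ β₀ ℓ₀ c C) {t : ℝ} (ht : 0 < t) :
    PackageWith r (fun β => t * a β) (fun s => Γ (s / t)) β₀ (t * ℓ₀) c C := by
  obtain ⟨hℓ, hc, hpos, hlim, hΓ, hbox⟩ := h
  refine ⟨mul_pos ht hℓ, hc, fun β => mul_pos ht (hpos β), by simpa using hlim.const_mul t,
    fun s hs hsl => ?_, fun L _ β hβ hL => ?_⟩
  · have h1 : 0 < s / t := div_pos hs ht
    have h2 : s / t ≤ ℓ₀ := by
      rw [div_le_iff₀ ht]
      linarith [mul_comm t ℓ₀]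
    exact hΓ _ h1 h2
  · rw [boxBounds_smul_iff r a Γ c C L β ht.ne']
    refine hbox L β hβ ?_
    have h' : t * ((L : ℝ) * a β) ≤ t * ℓ₀ := by
      calc t * ((L : ℝ) * a β) = (L : ℝ) * (t * a β) := by ring
        _ ≤ t * ℓ₀ := hL
    exact le_of_mul_le_mul_left h' ht

/-- Scale covariance of the package (existential form). [folklore] -/
theorem package_smul (r : LatticeRep G) {a : ℝ → ℝ} (h : Package r a) {t : ℝ} (ht : 0 < t) :
    Package r (fun β => t * a β) := by
  obtain ⟨Γ, β₀, ℓ₀, c, C, h⟩ := h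
  exact ⟨_, _, _, _, _, packageWith_smul r h ht⟩

/-- Scale covariance of the package, `iff` form. [folklore] -/
theorem package_smul_iff (r : LatticeRep G) (a : ℝ → ℝ) {t : ℝ} (ht : 0 < t) :
    Package r (fun β => t * a β) ↔ Package r a := by
  refine ⟨fun h => ?_, fun h => package_smul r h ht⟩
  have h' := package_smul r h (inv_pos.2 ht)
  have : (fun β => t⁻¹ * (t * a β)) = a := funext fun β => by field_simp
  rwa [this] at h'

/-- Rescaling the unit map rescales the rate constant: `ConclRate (t a) c₁ ↔ ConclRate a (c₁ t)`. [folklore] -/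
theorem conclRate_smul_iff (r : LatticeRep G) (a : ℝ → ℝ) (c₁ t : ℝ) :
    ConclRate r (fun β => t * a β) c₁ ↔ ConclRate r a (c₁ * t) := by
  simp only [ConclRate, mul_assoc]

/-- **Scale covariance of the conclusion**: `Concl (t a) ↔ Concl a` for `t > 0` — the rate constant `c₁` of the
crux is not intrinsic; only the CLASS of `a` up to constants is seen. [folklore] -/
theorem concl_smul_iff (r : LatticeRep G) (a : ℝ → ℝ) {t : ℝ} (ht : 0 < t) :
    Concl r (fun β => t * a β) ↔ Concl r a := by
  rw [concl_iff_exists_rate, concl_iff_exists_rate]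
  constructor
  · rintro ⟨c₁, hc, h⟩
    exact ⟨c₁ * t, mul_pos hc ht, (conclRate_smul_iff r a c₁ t).1 h⟩
  · rintro ⟨c₁, hc, h⟩
    refine ⟨c₁ / t, div_pos hc ht, (conclRate_smul_iff r a (c₁ / t) t).2 ?_⟩
    rwa [div_mul_cancel₀ c₁ ht.ne']

end Scale

/-! ## §3 Junk audit: a trivial gauge group makes the PACKAGE unsatisfiable (no junk refutation) -/

section Junk

variable {G : Type} [Group G] [TopologicalSpace G] [IsTopologicalGroup G] [CompactSpace G]
  [MeasurableSpace G] [BorelSpace G]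

/-- For a trivial (subsingleton) gauge group every torus observable is constant, so every Wilson expectation is
evaluation at the trivial configuration. [folklore] -/
theorem wilsonExpectation_eq_apply_one_of_subsingleton [Subsingleton G] (r : LatticeRep G) (β : ℝ) (L : ℕ)
    [NeZero L] (F : GaugeConfig 4 L G → ℝ) :
    wilsonExpectation (d := 4) (L := L) r.ρ β F = F 1 := by
  haveI := isProbabilityMeasure_wilsonMeasure (d := 4) (L := L) r.ρ r.continuous β
  have hF : F = fun _ => F 1 := funext fun U => congrArg F (Subsingleton.elim _ _)
  rw [hF]
  simp [wilsonExpectation]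

/-- **No junk refutation through the gauge group.** For a subsingleton `G` (the only junk group a deletion of
`IsCompactSimpleLieGroup` would admit that we can compute with) every plaquette covariance vanishes, so the
two-sided axis bound `0 < c Γ(a(β)) ≤ Cov` fails in the box `L = 8` at large `β`: the PACKAGE is unsatisfiable
and the crux holds vacuously there. Dropping simplicity does not open a formal kill; finite and abelian groups are
excluded by `IsSimpleCompactGroup` anyway, and for `U(1)₄` (Coulomb phase, barrier `AbelianDeconfinementD4`) the
package is as unverified as for `SU(N)`. [folklore] -/
theorem not_package_of_subsingleton [Subsingleton G] (r : LatticeRep G) (a : ℝ → ℝ) : ¬ Package r a := by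
  rintro ⟨Γ, β₀, ℓ₀, c, C, hℓ, hc, hpos, hlim, hΓ, hbox⟩
  have hev : ∀ᶠ β in atTop, a β < ℓ₀ / 8 := hlim (Iio_mem_nhds (by positivity))
  obtain ⟨β, hβ₀, hβ⟩ := ((eventually_ge_atTop β₀).and hev).exists
  haveI : NeZero (8 : ℕ) := ⟨by norm_num⟩
  have hB : BoxBounds r a Γ c C 8 β := hbox 8 β hβ₀ (by push_cast; linarith)
  obtain ⟨hax, -⟩ := hB
  have h1 := (hax 1 le_rfl (by norm_num)).1
  simp only [Nat.cast_one, one_mul, one_pow, wilsonExpectation_eq_apply_one_of_subsingleton, sub_self,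
    mul_zero] at h1
  have hΓ1 := (hΓ (a β) (hpos β) (by linarith)).1
  nlinarith

/-- Consequently the crux restricted to a trivial gauge group is TRUE (vacuously) — whatever one deletes from
`IsCompactSimpleLieGroup`. [folklore] -/
theorem crux_at_subsingleton [Subsingleton G] (r : LatticeRep G) (a : ℝ → ℝ) : Package r a → Concl r a :=
  fun h => (not_package_of_subsingleton r a h).elim

end Junk

/-! ## §4 Load-bearing clause `a(β) → 0`: without it the package is VACUOUSLY satisfiable -/

section WithoutTendsto

variable {G : Type} [Group G] [TopologicalSpace G] [IsTopologicalGroup G] [CompactSpace G]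
  [MeasurableSpace G] [BorelSpace G]

/-- The package with the clause `Tendsto a atTop (𝓝 0)` deleted. [folklore] -/
def PackageWithoutTendsto (r : LatticeRep G) (a : ℝ → ℝ) : Prop :=
  ∃ (Γ : ℝ → ℝ) (β₀ ℓ₀ c C : ℝ), 0 < ℓ₀ ∧ 0 < c ∧ (∀ β, 0 < a β) ∧
    (∀ s : ℝ, 0 < s → s ≤ ℓ₀ → 0 < Γ s ∧ Γ s ≤ 1) ∧
      ∀ (L : ℕ) [NeZero L] (β : ℝ), β₀ ≤ β → (L : ℝ) * a β ≤ ℓ₀ → BoxBounds r a Γ c C L β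

/-- **Without `a → 0` the package is vacuous**: the constant unit map `a ≡ 2` with `ℓ₀ = 1` admits NO box
(`L · 2 ≤ 1` is impossible for `L ≥ 1`), so all box bounds hold for lack of boxes. [folklore] -/
theorem packageWithoutTendsto_const_two (r : LatticeRep G) : PackageWithoutTendsto r (fun _ => 2) := by
  refine ⟨fun _ => 1, 0, 1, 1, 1, one_pos, one_pos, fun _ => two_pos, fun s _ _ => ⟨one_pos, le_rfl⟩,
    fun L _ β _ hL => ?_⟩
  exfalso
  have : (1 : ℝ) ≤ L := by exact_mod_cast NeZero.one_le
  linarith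

end WithoutTendsto

/-- The crux with the clause `a(β) → 0` deleted from its hypothesis. [folklore] -/
def CruxWithoutTendsto : Prop :=
  ∀ (G : Type) [Group G] [TopologicalSpace G] [IsTopologicalGroup G] [CompactSpace G],
    IsCompactSimpleLieGroup G →
      letI : MeasurableSpace G := borel G
      haveI : BorelSpace G := ⟨rfl⟩
      ∀ (r : LatticeRep G) (a : ℝ → ℝ), PackageWithoutTendsto r a → Concl r a

/-- **Uniform lattice-unit gap at weak coupling**: for every compact simple `G` and faithful `r`, all pairs of
gauge-invariant local observables cluster on all large tori at ONE `β`-independent rate per lattice step for all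
`β ≥ β₂` — i.e. the correlation length in LATTICE units stays bounded as `β → ∞`. Physically false for every
asymptotically free theory (no scaling continuum limit: barrier `Literature.Barriers.QuantumFields.FixedCouplingUltralocality`;
contradicts the `ξ(β) → ∞` clause of the registered open problem
`Literature.MathematicalPhysics.QuantumFieldTheory.LatticeMassGapAllCouplings`, Chatterjee arXiv:1803.01950
Problem 5.1), but NOT refutable today: a rigorous `ξ(β) → ∞` for a 4D non-abelian theory is open. [folklore] -/
def UniformLatticeUnitGap : Prop :=
  ∀ (G : Type) [Group G] [TopologicalSpace G] [IsTopologicalGroup G] [CompactSpace G],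
    IsCompactSimpleLieGroup G →
      letI : MeasurableSpace G := borel G
      haveI : BorelSpace G := ⟨rfl⟩
      ∀ (r : LatticeRep G), Concl r (fun _ => 1)

/-- **`a(β) → 0` is load-bearing against vacuity.** Deleting it turns the crux into (at least) the uniform
lattice-unit gap at weak coupling, via the box-free constant unit map. [folklore] -/
theorem uniformLatticeUnitGap_of_cruxWithoutTendsto (h : CruxWithoutTendsto) : UniformLatticeUnitGap := by
  intro G _ _ _ _ hG r
  letI : MeasurableSpace G := borel G
  haveI : BorelSpace G := ⟨rfl⟩
  have h2 := h G hG r (fun _ => 2) (packageWithoutTendsto_const_two r)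
  have e : (fun _ : ℝ => (2 : ℝ)) = fun β => 2 * (fun _ : ℝ => (1 : ℝ)) β := by
    funext; norm_num
  rw [e] at h2
  exact (concl_smul_iff r _ two_pos).1 h2

/-! ## §5 Germ dependence of the package -/

section Germ

variable {G : Type} [Group G] [TopologicalSpace G] [IsTopologicalGroup G] [CompactSpace G]
  [MeasurableSpace G] [BorelSpace G]

/-- Box bounds depend on the unit map only through its value at the box's coupling. [folklore] -/
theorem boxBounds_congr (r : LatticeRep G) {a b : ℝ → ℝ} (Γ : ℝ → ℝ) (c C : ℝ) (L : ℕ) [NeZero L] (β : ℝ)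
    (e : b β = a β) : BoxBounds r b Γ c C L β ↔ BoxBounds r a Γ c C L β := by
  simp only [BoxBounds, e]

/-- Only the germ of the unit map at `β = +∞` (plus global positivity) matters for the package: push `β₀` up.
So a prover/disprover may redefine `a` arbitrarily on any bounded range of couplings. [folklore] -/
theorem package_of_eventuallyEq (r : LatticeRep G) {a b : ℝ → ℝ} (h : Package r a) (hb : ∀ β, 0 < b β)
    (hab : ∀ᶠ β in atTop, b β = a β) : Package r b := by
  obtain ⟨Γ, β₀, ℓ₀, c, C, hℓ, hc, -, hlim, hΓ, hbox⟩ := h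
  obtain ⟨βs, hβs⟩ := eventually_atTop.1 hab
  refine ⟨Γ, max β₀ βs, ℓ₀, c, C, hℓ, hc, hb, hlim.congr' (hab.mono fun _ h => h.symm), hΓ,
    fun L _ β hβ hL => ?_⟩
  have e : b β = a β := hβs β ((le_max_right _ _).trans hβ)
  rw [boxBounds_congr r Γ c C L β e]
  exact hbox L β ((le_max_left _ _).trans hβ) (by rwa [← e])

end Germ

/-! ## §6 Weak-coupling concentration on a fixed torus; the shape function must vanish along `a` -/

section Concentration

variable {G : Type} [Group G] [TopologicalSpace G] [IsTopologicalGroup G] [CompactSpace G]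
  [MeasurableSpace G] [BorelSpace G]

/-- `Re tr U ≤ N` for a unitary `N × N` matrix (entries bounded by `1`). [folklore] -/
theorem re_trace_le_card {N : ℕ} {U : Matrix (Fin N) (Fin N) ℂ} (hU : U ∈ Matrix.unitaryGroup (Fin N) ℂ) :
    U.trace.re ≤ N := by
  calc U.trace.re = ∑ i, (U i i).re := by rw [Matrix.trace]; simp [Complex.re_sum]
    _ ≤ ∑ _i : Fin N, (1 : ℝ) :=
        Finset.sum_le_sum fun i _ => (Complex.re_le_norm _).trans (entry_norm_bound_of_unitary hU i i)
    _ = N := by simp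

/-- `−N ≤ Re tr U` for a unitary `N × N` matrix. [folklore] -/
theorem neg_card_le_re_trace {N : ℕ} {U : Matrix (Fin N) (Fin N) ℂ} (hU : U ∈ Matrix.unitaryGroup (Fin N) ℂ) :
    -(N : ℝ) ≤ U.trace.re := by
  have h : ∑ _i : Fin N, (-1 : ℝ) ≤ ∑ i, (U i i).re :=
    Finset.sum_le_sum fun i _ =>
      (abs_le.1 ((Complex.abs_re_le_norm (U i i)).trans (entry_norm_bound_of_unitary hU i i))).1
  calc -(N : ℝ) = ∑ _i : Fin N, (-1 : ℝ) := by simp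
    _ ≤ ∑ i, (U i i).re := h
    _ = U.trace.re := by rw [Matrix.trace]; simp [Complex.re_sum]

/-- The plaquette field `P_x^{ij}(U) = N − Re tr r(U_{x,ij})` of the route file (the `P` of `BoxBounds`).
[folklore] -/
def plaq (r : LatticeRep G) {L : ℕ} (x : Fin 4 → ZMod L) (i j : Fin 4) (U : GaugeConfig 4 L G) : ℝ :=
  (r.N : ℝ) - (r.ρ (plaquetteHolonomy U x i j)).trace.re

omit [IsTopologicalGroup G] [CompactSpace G] [MeasurableSpace G] [BorelSpace G] in
/-- `0 ≤ P`. [folklore] -/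
theorem plaq_nonneg (r : LatticeRep G) {L : ℕ} (x : Fin 4 → ZMod L) (i j : Fin 4) (U : GaugeConfig 4 L G) :
    0 ≤ plaq r x i j U :=
  sub_nonneg.2 (re_trace_le_card (r.mem_unitary _))

omit [IsTopologicalGroup G] [CompactSpace G] [MeasurableSpace G] [BorelSpace G] in
/-- `P ≤ 2N`. [folklore] -/
theorem plaq_le (r : LatticeRep G) {L : ℕ} (x : Fin 4 → ZMod L) (i j : Fin 4) (U : GaugeConfig 4 L G) :
    plaq r x i j U ≤ 2 * r.N := by
  have := neg_card_le_re_trace (r.mem_unitary (plaquetteHolonomy U x i j))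
  unfold plaq
  linarith

omit [IsTopologicalGroup G] [CompactSpace G] [MeasurableSpace G] [BorelSpace G] in
/-- `|P| ≤ 2N`. [folklore] -/
theorem abs_plaq_le (r : LatticeRep G) {L : ℕ} (x : Fin 4 → ZMod L) (i j : Fin 4) (U : GaugeConfig 4 L G) :
    |plaq r x i j U| ≤ 2 * r.N :=
  abs_le.2 ⟨by linarith [plaq_nonneg r x i j U, plaq_le r x i j U], plaq_le r x i j U⟩

omit [CompactSpace G] [MeasurableSpace G] [BorelSpace G] in
/-- The plaquette field is continuous. [folklore] -/
theorem continuous_plaq (r : LatticeRep G) {L : ℕ} (x : Fin 4 → ZMod L) (i j : Fin 4) :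
    Continuous (plaq r x i j : GaugeConfig 4 L G → ℝ) := by
  have h1 : Continuous fun U : GaugeConfig 4 L G => plaquetteHolonomy U x i j := by
    unfold plaquetteHolonomy; fun_prop
  exact continuous_const.sub (Complex.continuous_re.comp (r.continuous.comp h1).matrix_trace)

omit [CompactSpace G] [MeasurableSpace G] [BorelSpace G] in
/-- The Wilson action is continuous. [folklore] -/
theorem continuous_wilsonAction' (r : LatticeRep G) {L : ℕ} [NeZero L] :
    Continuous (wilsonAction (d := 4) (L := L) r.ρ : GaugeConfig 4 L G → ℝ) := by
  unfold wilsonAction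
  refine continuous_finsetSum _ fun p _ => ?_
  exact continuous_plaq r p.1 p.2.1.1 p.2.1.2

omit [IsTopologicalGroup G] [CompactSpace G] [MeasurableSpace G] [BorelSpace G] in
/-- The Wilson action is non-negative (unitary representation). [folklore] -/
theorem wilsonAction_nonneg' (r : LatticeRep G) {L : ℕ} [NeZero L] (U : GaugeConfig 4 L G) :
    0 ≤ wilsonAction (d := 4) (L := L) r.ρ U :=
  Finset.sum_nonneg fun p _ => plaq_nonneg r p.1 p.2.1.1 p.2.1.2 U

omit [IsTopologicalGroup G] [CompactSpace G] [MeasurableSpace G] [BorelSpace G] in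
/-- A single plaquette is bounded by the action (all other terms are non-negative). [folklore] -/
theorem plaq_le_wilsonAction (r : LatticeRep G) {L : ℕ} [NeZero L] (x : Fin 4 → ZMod L) {i j : Fin 4}
    (hij : i < j) (U : GaugeConfig 4 L G) : plaq r x i j U ≤ wilsonAction (d := 4) (L := L) r.ρ U := by
  have h := Finset.single_le_sum (f := fun p : Plaquette 4 L => plaq r p.1 p.2.1.1 p.2.1.2 U)
    (fun p _ => plaq_nonneg r _ _ _ U) (Finset.mem_univ ((x, ⟨(i, j), hij⟩) : Plaquette 4 L))
  simpa only [wilsonAction, plaq] using h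

omit [IsTopologicalGroup G] [CompactSpace G] [MeasurableSpace G] [BorelSpace G] in
/-- The trivial configuration has zero action. [folklore] -/
theorem wilsonAction_one' (r : LatticeRep G) {L : ℕ} [NeZero L] :
    wilsonAction (d := 4) (L := L) r.ρ (1 : GaugeConfig 4 L G) = 0 := by
  unfold wilsonAction
  refine Finset.sum_eq_zero fun p _ => ?_
  simp [plaquetteHolonomy, Matrix.trace_one]

/-- **Weak-coupling concentration of the fixed-torus Wilson measure on the zero-action set.** For every `ε > 0`
there is `p = p(ε, L, r) > 0` (the product-Haar mass of `{S < ε/2}`, positive because `S` is continuous, `S(1) = 0`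
and Haar charges open sets) with `μ_{β,L}{S ≥ ε} ≤ e^{−βε/2} / p` for all `β ≥ 0`: `Z ≥ e^{−βε/2} p` and the
weight of `{S ≥ ε}` is at most `e^{−βε}`. (Laplace principle; the first rigorous step of "perturbative" control at
fixed `L`.) [folklore] -/
theorem wilsonMeasure_real_action_ge_le (r : LatticeRep G) (L : ℕ) [NeZero L] {ε : ℝ} (hε : 0 < ε) :
    ∃ p : ℝ, 0 < p ∧ ∀ β : ℝ, 0 ≤ β →
      (wilsonMeasure (d := 4) (L := L) r.ρ β).real {U | ε ≤ wilsonAction r.ρ U} ≤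
        Real.exp (-(β * (ε / 2))) / p := by
  haveI : SecondCountableTopology G :=
    (r.continuous.isClosedEmbedding r.injective).isEmbedding.secondCountableTopology
  set π : Measure (GaugeConfig 4 L G) := Measure.pi fun _ : Edge 4 L => haarProbability G with hπ
  haveI : (haarProbability G).IsOpenPosMeasure := by rw [haarProbability]; infer_instance
  haveI hπpos : π.IsOpenPosMeasure := by rw [hπ]; infer_instance
  set O : Set (GaugeConfig 4 L G) := {U | wilsonAction (d := 4) (L := L) r.ρ U < ε / 2} with hO
  have hOopen : IsOpen O := isOpen_lt (continuous_wilsonAction' r) continuous_const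
  have hOne : (1 : GaugeConfig 4 L G) ∈ O := by
    show wilsonAction (d := 4) (L := L) r.ρ 1 < ε / 2
    rw [wilsonAction_one' r]
    exact half_pos hε
  have hπO : 0 < π O := hOopen.measure_pos π ⟨1, hOne⟩
  have hπO' : π O ≠ ⊤ := measure_ne_top π O
  refine ⟨(π O).toReal, ENNReal.toReal_pos hπO.ne' hπO', fun β hβ => ?_⟩
  set Sε : Set (GaugeConfig 4 L G) := {U | ε ≤ wilsonAction (d := 4) (L := L) r.ρ U} with hSε
  set f : GaugeConfig 4 L G → ENNReal :=
    fun U => ENNReal.ofReal (Real.exp (-β * wilsonAction (d := 4) (L := L) r.ρ U)) with hf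
  have hfm : Measurable f :=
    (ENNReal.continuous_ofReal.comp (Real.continuous_exp.comp
      (continuous_const.mul (continuous_wilsonAction' r)))).measurable
  have hZ_def : partitionFunction (d := 4) (L := L) r.ρ β = ∫⁻ U, f U ∂π := by
    simp only [partitionFunction, wilsonWeight, withDensity_apply _ MeasurableSet.univ,
      Measure.restrict_univ, hπ, hf]
  -- lower bound on the partition function from the neighbourhood `O` of the trivial configuration
  have hZlow : ENNReal.ofReal (Real.exp (-(β * (ε / 2)))) * π O ≤
      partitionFunction (d := 4) (L := L) r.ρ β := by
    rw [hZ_def]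
    calc ENNReal.ofReal (Real.exp (-(β * (ε / 2)))) * π O
        = ∫⁻ _U in O, ENNReal.ofReal (Real.exp (-(β * (ε / 2)))) ∂π := (setLIntegral_const O _).symm
      _ ≤ ∫⁻ U in O, f U ∂π := by
          refine setLIntegral_mono hfm fun U hU => ENNReal.ofReal_le_ofReal (Real.exp_le_exp.2 ?_)
          have hU' : wilsonAction (d := 4) (L := L) r.ρ U < ε / 2 := hU
          have := mul_le_mul_of_nonneg_left hU'.le hβ
          linarith
      _ ≤ ∫⁻ U, f U ∂π := setLIntegral_le_lintegral O f
  -- upper bound on the weight of the large-action set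
  have hW : wilsonWeight (d := 4) (L := L) r.ρ β Sε ≤ ENNReal.ofReal (Real.exp (-(β * ε))) := by
    have hWeq : wilsonWeight (d := 4) (L := L) r.ρ β Sε = ∫⁻ U in Sε, f U ∂π := by
      simp only [wilsonWeight, hπ, hf]
      rw [withDensity_apply']
    rw [hWeq]
    calc ∫⁻ U in Sε, f U ∂π ≤ ∫⁻ _U in Sε, ENNReal.ofReal (Real.exp (-(β * ε))) ∂π := by
          refine setLIntegral_mono measurable_const fun U hU =>
            ENNReal.ofReal_le_ofReal (Real.exp_le_exp.2 ?_)
          have hU' : ε ≤ wilsonAction (d := 4) (L := L) r.ρ U := hU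
          have := mul_le_mul_of_nonneg_left hU' hβ
          linarith
      _ = ENNReal.ofReal (Real.exp (-(β * ε))) * π Sε := setLIntegral_const _ _
      _ ≤ ENNReal.ofReal (Real.exp (-(β * ε))) * 1 := mul_le_mul' le_rfl prob_le_one
      _ = ENNReal.ofReal (Real.exp (-(β * ε))) := mul_one _
  have hμ : (wilsonMeasure (d := 4) (L := L) r.ρ β) Sε =
      (partitionFunction (d := 4) (L := L) r.ρ β)⁻¹ * wilsonWeight (d := 4) (L := L) r.ρ β Sε := by
    simp [wilsonMeasure]
  have hne : ENNReal.ofReal (Real.exp (-(β * (ε / 2)))) * π O ≠ 0 :=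
    mul_ne_zero (by simp [Real.exp_pos]) hπO.ne'
  have hbound : (wilsonMeasure (d := 4) (L := L) r.ρ β) Sε ≤
      (ENNReal.ofReal (Real.exp (-(β * (ε / 2)))) * π O)⁻¹ * ENNReal.ofReal (Real.exp (-(β * ε))) := by
    rw [hμ]
    exact mul_le_mul' (ENNReal.inv_le_inv.2 hZlow) hW
  have htop : (ENNReal.ofReal (Real.exp (-(β * (ε / 2)))) * π O)⁻¹ * ENNReal.ofReal (Real.exp (-(β * ε))) ≠ ⊤ :=
    ENNReal.mul_ne_top (ENNReal.inv_ne_top.2 hne) ENNReal.ofReal_ne_top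
  rw [measureReal_def]
  refine (ENNReal.toReal_mono htop hbound).trans (le_of_eq ?_)
  rw [ENNReal.toReal_mul, ENNReal.toReal_inv, ENNReal.toReal_mul, ENNReal.toReal_ofReal (Real.exp_pos _).le,
    ENNReal.toReal_ofReal (Real.exp_pos _).le]
  have hexp : Real.exp (-(β * ε)) = Real.exp (-(β * (ε / 2))) * Real.exp (-(β * (ε / 2))) := by
    rw [← Real.exp_add]; ring_nf
  rw [hexp]
  have hp : (π O).toReal ≠ 0 := (ENNReal.toReal_pos hπO.ne' hπO').ne'
  have he : Real.exp (-(β * (ε / 2))) ≠ 0 := (Real.exp_pos _).ne'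
  field_simp

/-- **The mean plaquette vanishes at weak coupling on a fixed torus**: `E_{β,L}[P_x^{ij}] → 0` as `β → ∞`
(`0 ≤ P ≤ S` pointwise for `i < j`, `P ≤ 2N`, and concentration). [folklore] -/
theorem tendsto_wilsonExpectation_plaq (r : LatticeRep G) (L : ℕ) [NeZero L] (x : Fin 4 → ZMod L)
    {i j : Fin 4} (hij : i < j) :
    Tendsto (fun β => wilsonExpectation (d := 4) (L := L) r.ρ β (plaq r x i j)) atTop (𝓝 0) := by
  haveI : SecondCountableTopology G :=
    (r.continuous.isClosedEmbedding r.injective).isEmbedding.secondCountableTopology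
  have key : ∀ ε : ℝ, 0 < ε → ∃ p : ℝ, 0 < p ∧ ∀ β : ℝ, 0 ≤ β →
      wilsonExpectation (d := 4) (L := L) r.ρ β (plaq r x i j) ≤
        ε + 2 * r.N * (Real.exp (-(β * (ε / 2))) / p) := by
    intro ε hε
    obtain ⟨p, hp, hconc⟩ := wilsonMeasure_real_action_ge_le r L hε
    refine ⟨p, hp, fun β hβ => ?_⟩
    haveI := isProbabilityMeasure_wilsonMeasure (d := 4) (L := L) r.ρ r.continuous β
    set μ := wilsonMeasure (d := 4) (L := L) r.ρ β with hμ
    set Sε : Set (GaugeConfig 4 L G) := {U | ε ≤ wilsonAction (d := 4) (L := L) r.ρ U} with hSε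
    have hSm : MeasurableSet Sε :=
      measurableSet_le measurable_const (measurable_wilsonAction (d := 4) (L := L) r.ρ r.continuous)
    have hpt : ∀ U, plaq r x i j U ≤ ε + 2 * r.N * Sε.indicator (fun _ => (1 : ℝ)) U := by
      intro U
      by_cases hU : U ∈ Sε
      · rw [Set.indicator_of_mem hU, mul_one]
        have := plaq_le r x i j U
        linarith
      · rw [Set.indicator_of_notMem hU, mul_zero, add_zero]
        have hlt : wilsonAction (d := 4) (L := L) r.ρ U < ε := not_le.1 hU
        exact ((plaq_le_wilsonAction r x hij U).trans hlt.le)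
    have hint1 : Integrable (plaq r x i j) μ :=
      Integrable.of_bound (continuous_plaq r x i j).aestronglyMeasurable (2 * r.N)
        (Eventually.of_forall fun U => by rw [Real.norm_eq_abs]; exact abs_plaq_le r x i j U)
    have hint2 : Integrable (fun U => ε + 2 * r.N * Sε.indicator (fun _ => (1 : ℝ)) U) μ :=
      (integrable_const ε).add (((integrable_const (1 : ℝ)).indicator hSm).const_mul (2 * (r.N : ℝ)))
    calc wilsonExpectation (d := 4) (L := L) r.ρ β (plaq r x i j) = ∫ U, plaq r x i j U ∂μ := rfl
      _ ≤ ∫ U, (ε + 2 * r.N * Sε.indicator (fun _ => (1 : ℝ)) U) ∂μ := integral_mono hint1 hint2 hpt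
      _ = ε + 2 * r.N * μ.real Sε := by
          rw [integral_add (integrable_const ε)
            (((integrable_const (1 : ℝ)).indicator hSm).const_mul (2 * (r.N : ℝ))),
            integral_const, integral_const_mul, integral_indicator_const _ hSm]
          simp
      _ ≤ ε + 2 * r.N * (Real.exp (-(β * (ε / 2))) / p) := by
          have hN : (0 : ℝ) ≤ 2 * r.N := by positivity
          have := hconc β hβ
          nlinarith
  rw [tendsto_order]
  refine ⟨fun δ hδ => Eventually.of_forall fun β => hδ.trans_le ?_, fun δ hδ => ?_⟩
  · exact integral_nonneg fun U => plaq_nonneg r x i j U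
  · obtain ⟨p, hp, hkey⟩ := key (δ / 2) (half_pos hδ)
    have ht : Tendsto (fun β : ℝ => 2 * (r.N : ℝ) * (Real.exp (-(β * (δ / 2 / 2))) / p)) atTop (𝓝 0) := by
      have h1 : Tendsto (fun β : ℝ => Real.exp (-(β * (δ / 2 / 2)))) atTop (𝓝 0) :=
        Real.tendsto_exp_atBot.comp
          (tendsto_neg_atTop_atBot.comp (tendsto_id.atTop_mul_const (by positivity)))
      simpa using (h1.div_const p).const_mul (2 * (r.N : ℝ))
    have hev : ∀ᶠ β : ℝ in atTop, 2 * (r.N : ℝ) * (Real.exp (-(β * (δ / 2 / 2))) / p) < δ / 2 :=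
      (tendsto_order.1 ht).2 _ (half_pos hδ)
    filter_upwards [hev, eventually_ge_atTop (0 : ℝ)] with β hβ hβ0
    calc wilsonExpectation (d := 4) (L := L) r.ρ β (plaq r x i j)
        ≤ δ / 2 + 2 * r.N * (Real.exp (-(β * (δ / 2 / 2))) / p) := hkey β hβ0
      _ < δ / 2 + δ / 2 := by linarith
      _ = δ := by ring

/-- **Plaquette covariances vanish at weak coupling on a fixed torus**: for `i < j`, `i' < j'` and all sites,
`Cov_{β,L}(P_x^{ij}, P_y^{i'j'}) → 0` as `β → ∞` (`0 ≤ E[P P'] ≤ 2N E[P'] → 0` and `E[P] E[P'] → 0`). The formal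
shadow of `n⁸ Cov = O(g₀⁴) = O(β⁻²)` at the scale of one lattice spacing. [folklore] -/
theorem tendsto_cov_plaq (r : LatticeRep G) (L : ℕ) [NeZero L] (x y : Fin 4 → ZMod L) {i j i' j' : Fin 4}
    (hij : i < j) (hij' : i' < j') :
    Tendsto (fun β => wilsonExpectation (d := 4) (L := L) r.ρ β (fun U => plaq r x i j U * plaq r y i' j' U) -
      wilsonExpectation (d := 4) (L := L) r.ρ β (plaq r x i j) *
        wilsonExpectation (d := 4) (L := L) r.ρ β (plaq r y i' j')) atTop (𝓝 0) := by
  haveI : SecondCountableTopology G :=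
    (r.continuous.isClosedEmbedding r.injective).isEmbedding.secondCountableTopology
  have h1 := tendsto_wilsonExpectation_plaq r L x hij
  have h2 := tendsto_wilsonExpectation_plaq r L y hij'
  have h3 : Tendsto (fun β => wilsonExpectation (d := 4) (L := L) r.ρ β
      (fun U => plaq r x i j U * plaq r y i' j' U)) atTop (𝓝 0) := by
    refine tendsto_of_tendsto_of_tendsto_of_le_of_le tendsto_const_nhds
      (by simpa using h2.const_mul (2 * (r.N : ℝ))) (fun β => ?_) (fun β => ?_)
    · exact integral_nonneg fun U => mul_nonneg (plaq_nonneg r x i j U) (plaq_nonneg r y i' j' U)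
    · haveI := isProbabilityMeasure_wilsonMeasure (d := 4) (L := L) r.ρ r.continuous β
      have hintR : Integrable (fun U => 2 * (r.N : ℝ) * plaq r y i' j' U)
          (wilsonMeasure (d := 4) (L := L) r.ρ β) :=
        (Integrable.of_bound (continuous_plaq r y i' j').aestronglyMeasurable (2 * r.N)
          (Eventually.of_forall fun U => by
            rw [Real.norm_eq_abs]; exact abs_plaq_le r y i' j' U)).const_mul _
      have hintL : Integrable (fun U => plaq r x i j U * plaq r y i' j' U)
          (wilsonMeasure (d := 4) (L := L) r.ρ β) :=
        Integrable.of_bound ((continuous_plaq r x i j).mul (continuous_plaq r y i' j')).aestronglyMeasurable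
          (2 * r.N * (2 * r.N)) (Eventually.of_forall fun U => by
            rw [Real.norm_eq_abs, abs_mul]
            exact mul_le_mul (abs_plaq_le r x i j U) (abs_plaq_le r y i' j' U) (abs_nonneg _)
              (by positivity))
      calc wilsonExpectation (d := 4) (L := L) r.ρ β (fun U => plaq r x i j U * plaq r y i' j' U)
          = ∫ U, plaq r x i j U * plaq r y i' j' U ∂(wilsonMeasure (d := 4) (L := L) r.ρ β) := rfl
        _ ≤ ∫ U, 2 * (r.N : ℝ) * plaq r y i' j' U ∂(wilsonMeasure (d := 4) (L := L) r.ρ β) :=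
            integral_mono hintL hintR fun U =>
              mul_le_mul_of_nonneg_right (plaq_le r x i j U) (plaq_nonneg r y i' j' U)
        _ = 2 * (r.N : ℝ) * wilsonExpectation (d := 4) (L := L) r.ρ β (plaq r y i' j') :=
            integral_const_mul _ _
  simpa using h3.sub (h1.mul h2)

/-- **TIGHTNESS OF `0 < Γ`: the shape function of ANY femto package vanishes along the unit map.** If
`PackageWith r a Γ β₀ ℓ₀ c C` then `Γ(a(β)) → 0` as `β → ∞`: the box `L = 8`, `n = 1` gives
`c Γ(a(β)) ≤ Cov_{β,8}(P₀^{01}, P_{e₂}^{01}) → 0`. So no package has `inf_{(0,ℓ₀]} Γ > 0`; the planner's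
"asymptotic-freedom dividend `Γ(s) → 0⁺`", deliberately NOT typed into the crux, is nevertheless FORCED on the
grid `s = a(β)` — by mere concentration, with no perturbation theory. For provers of `FemtoCurvatureTwoPoint`:
your `Γ` must decay at `0⁺` at least as fast as the one-plaquette-pair covariance of the `8⁴` torus. [folklore] -/
theorem packageWith_shape_tendsto_zero (r : LatticeRep G) {a Γ : ℝ → ℝ} {β₀ ℓ₀ c C : ℝ}
    (h : PackageWith r a Γ β₀ ℓ₀ c C) : Tendsto (fun β => Γ (a β)) atTop (𝓝 0) := by
  obtain ⟨hℓ, hc, hpos, hlim, hΓ, hbox⟩ := h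
  haveI : NeZero (8 : ℕ) := ⟨by norm_num⟩
  set cov : ℝ → ℝ := fun β =>
    wilsonExpectation (d := 4) (L := 8) r.ρ β (fun U => ((r.N : ℝ) - (r.ρ (plaquetteHolonomy U 0 0 1)).trace.re) *
        ((r.N : ℝ) - (r.ρ (plaquetteHolonomy U (Pi.single (2 : Fin 4) ((1 : ℕ) : ZMod 8)) 0 1)).trace.re)) -
      wilsonExpectation (d := 4) (L := 8) r.ρ β (fun U => (r.N : ℝ) - (r.ρ (plaquetteHolonomy U 0 0 1)).trace.re) *
        wilsonExpectation (d := 4) (L := 8) r.ρ β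
          (fun U => (r.N : ℝ) - (r.ρ (plaquetteHolonomy U (Pi.single (2 : Fin 4) ((1 : ℕ) : ZMod 8)) 0 1)).trace.re)
    with hcov
  have hcov0 : Tendsto cov atTop (𝓝 0) :=
    tendsto_cov_plaq r 8 0 (Pi.single (2 : Fin 4) ((1 : ℕ) : ZMod 8)) (i := 0) (j := 1) (i' := 0) (j' := 1)
      (by decide) (by decide)
  have hev : ∀ᶠ β in atTop, a β < ℓ₀ / 8 := hlim (Iio_mem_nhds (by positivity))
  have hkey : ∀ᶠ β in atTop, 0 ≤ Γ (a β) ∧ Γ (a β) ≤ cov β / c := by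
    filter_upwards [hev, eventually_ge_atTop β₀] with β hβ hβ₀
    have hB : BoxBounds r a Γ c C 8 β := hbox 8 β hβ₀ (by push_cast; linarith)
    obtain ⟨hax, -⟩ := hB
    have h1 : c * Γ (((1 : ℕ) : ℝ) * a β) ≤ ((1 : ℕ) : ℝ) ^ 8 * cov β := (hax 1 le_rfl (by norm_num)).1
    simp only [Nat.cast_one, one_mul, one_pow] at h1
    have hΓ' := hΓ (a β) (hpos β) (by linarith)
    refine ⟨hΓ'.1.le, ?_⟩
    rw [le_div_iff₀ hc]
    linarith
  refine tendsto_of_tendsto_of_tendsto_of_le_of_le' tendsto_const_nhds ?_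
    (hkey.mono fun β h => h.1) (hkey.mono fun β h => h.2)
  simpa using hcov0.div_const c

/-- Hence **no femto package has a shape function bounded below** on `(0, ℓ₀]`. [folklore] -/
theorem not_packageWith_of_shape_ge (r : LatticeRep G) {a Γ : ℝ → ℝ} {β₀ ℓ₀ c C γ₀ : ℝ} (hγ : 0 < γ₀)
    (hΓ : ∀ s : ℝ, 0 < s → s ≤ ℓ₀ → γ₀ ≤ Γ s) : ¬ PackageWith r a Γ β₀ ℓ₀ c C := by
  intro h
  have ht := packageWith_shape_tendsto_zero r h
  obtain ⟨hℓ, -, hpos, hlim, -, -⟩ := h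
  have hev : ∀ᶠ β in atTop, a β < ℓ₀ := hlim (Iio_mem_nhds hℓ)
  have hlt : ∀ᶠ β in atTop, Γ (a β) < γ₀ := (tendsto_order.1 ht).2 _ hγ
  obtain ⟨β, h1, h2⟩ := (hev.and hlt).exists
  exact absurd (hΓ (a β) (hpos β) h1.le) (not_le.2 h2)

/-- The two constants of a package are ordered, `c ≤ C` (box `L = 8`, `n = 1`, `Γ > 0`). [folklore] -/
theorem packageWith_c_le_C (r : LatticeRep G) {a Γ : ℝ → ℝ} {β₀ ℓ₀ c C : ℝ}
    (h : PackageWith r a Γ β₀ ℓ₀ c C) : c ≤ C := by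
  obtain ⟨hℓ, -, hpos, hlim, hΓ, hbox⟩ := h
  haveI : NeZero (8 : ℕ) := ⟨by norm_num⟩
  have hev : ∀ᶠ β in atTop, a β < ℓ₀ / 8 := hlim (Iio_mem_nhds (by positivity))
  obtain ⟨β, hβ, hβ₀⟩ := (hev.and (eventually_ge_atTop β₀)).exists
  obtain ⟨hax, -⟩ := hbox 8 β hβ₀ (by push_cast; linarith)
  obtain ⟨h1, h2⟩ := hax 1 le_rfl (by norm_num)
  have hΓ' := (hΓ (((1 : ℕ) : ℝ) * a β) (by simpa using hpos β) (by simp; linarith)).1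
  exact le_of_mul_le_mul_right (h1.trans h2) hΓ'

end Concentration

/-! ## §7 A natural strengthening that IS formally false: one constant `C` for all pairs of observables -/

section UniformC

variable {G : Type} [Group G] [TopologicalSpace G] [IsTopologicalGroup G] [CompactSpace G]
  [MeasurableSpace G] [BorelSpace G]

/-- Scaling a gauge-invariant local observable by a real number. [folklore] -/
def smulObs (t : ℝ) (A : YMSpecies G) : YMSpecies G where
  F := fun U => t * A.F U
  supp := A.supp
  isCylinder := fun U V h => by
    show t * A.F U = t * A.F V
    rw [A.isCylinder h]
  gaugeInvariant := fun g U => by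
    show t * A.F _ = t * A.F U
    rw [A.gaugeInvariant g U]
  bounded := by
    obtain ⟨C, hC⟩ := A.bounded
    exact ⟨|t| * C, fun U => by rw [abs_mul]; exact mul_le_mul_of_nonneg_left (hC U) (abs_nonneg t)⟩
  measurable := A.measurable.const_mul t

omit [TopologicalSpace G] [IsTopologicalGroup G] [CompactSpace G] [BorelSpace G] in
/-- The field of the scaled observable. [folklore] -/
theorem smulObs_F (t : ℝ) (A : YMSpecies G) : (smulObs t A).F = fun U => t * A.F U := rfl

/-- Connected correlations are bilinear: `corr(tA, tB) = t² corr(A, B)`. [folklore] -/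
theorem latticeConnectedCorr_smul {N : ℕ} (ρ : G →* Matrix (Fin N) (Fin N) ℂ) (β : ℝ) (S : ℕ) [NeZero S]
    (t : ℝ) (A B : LGConfig 4 G → ℝ) (n : ℕ) :
    latticeConnectedCorr ρ β S (fun U => t * A U) (fun U => t * B U) n =
      t * t * latticeConnectedCorr ρ β S A B n := by
  unfold latticeConnectedCorr
  have h1 : (fun U : GaugeConfig 4 S G =>
      t * A (torusLift S U) * (t * B (configShift (-Pi.single 0 (n : ℤ)) (torusLift S U)))) =
      fun U => (t * t) * (A (torusLift S U) * B (configShift (-Pi.single 0 (n : ℤ)) (torusLift S U))) := by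
    funext U; ring
  rw [h1, integral_const_mul, integral_const_mul, integral_const_mul]
  ring

/-- The conclusion of the crux STRENGTHENED to one constant `C` uniform over all pairs `(A, B)` of observables
(`∃ C ∀ A B` instead of `∀ A B ∃ C`). [folklore] -/
def ConclUniformC (r : LatticeRep G) (a : ℝ → ℝ) : Prop :=
  ∃ (c₁ β₂ C : ℝ) (S₁ : ℝ → ℕ), 0 < c₁ ∧ ∀ A B : YMSpecies G, ∀ β : ℝ, β₂ ≤ β → ∀ S n : ℕ,
    S₁ β ≤ S → n ≤ S → |latticeConnectedCorr r.ρ β (2 * S + 1) A.F B.F n| ≤ C * Real.exp (-(c₁ * a β * n))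

/-- It is a strengthening. [folklore] -/
theorem concl_of_conclUniformC (r : LatticeRep G) (a : ℝ → ℝ) (h : ConclUniformC r a) : Concl r a := by
  obtain ⟨c₁, β₂, C, S₁, hc, h⟩ := h
  exact ⟨c₁, β₂, S₁, hc, fun A B => ⟨C, h A B⟩⟩

/-- **The uniform-`C` strengthening is FALSE for every non-abelian compact `G`** (in particular every compact simple
Lie group), every faithful `r` and every unit map: the curvature observable has positive variance under every Wilson
measure (tree `variance_pos`, `actionDensity_ne`), and `corr(tP, tP, 0) = t² Var(P)` is unbounded in `t`. The
order of quantifiers `∀ A B, ∃ C` in the crux (and in `HasLatticeMassGap`) is load-bearing; provers need the norms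
`‖Φ(A)Ω‖`, not a uniform constant. [folklore] -/
theorem not_conclUniformC (hG : ∃ g h : G, g * h ≠ h * g) (r : LatticeRep G) (a : ℝ → ℝ) :
    ¬ ConclUniformC r a := by
  rintro ⟨c₁, β₂, C, S₁, -, h⟩
  obtain ⟨g₁, g₂, hg⟩ := hG
  set S := S₁ β₂ with hS
  have hP : Continuous fun W : GaugeConfig 4 (2 * S + 1) G => r.curvature.F (torusLift (2 * S + 1) W) :=
    (continuous_actionDensity r.continuous).comp (continuous_pi fun _ => continuous_apply _)
  have hne : r.curvature.F (torusLift (2 * S + 1)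
      (fun e : Edge 4 (2 * S + 1) => if e.2 = 0 then g₁ else if e.2 = 1 then g₂ else (1 : G))) ≠
      r.curvature.F (torusLift (2 * S + 1) (fun _ => 1)) := by
    rw [torusLift_dirConfigT, torusLift_one]
    exact actionDensity_ne r hg
  have hvar := variance_pos r β₂ (2 * S + 1) hP hne
  set v := ∫ W, r.curvature.F (torusLift (2 * S + 1) W) * r.curvature.F (torusLift (2 * S + 1) W)
        ∂(wilsonMeasure (d := 4) (L := 2 * S + 1) r.ρ β₂) -
      (∫ W, r.curvature.F (torusLift (2 * S + 1) W) ∂(wilsonMeasure (d := 4) (L := 2 * S + 1) r.ρ β₂)) *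
        ∫ W, r.curvature.F (torusLift (2 * S + 1) W) ∂(wilsonMeasure (d := 4) (L := 2 * S + 1) r.ρ β₂) with hv
  have hle : ∀ t : ℝ, t * t * v ≤ C := fun t => by
    have h0 := h (smulObs t r.curvature) (smulObs t r.curvature) β₂ le_rfl S 0 le_rfl (Nat.zero_le _)
    rw [smulObs_F, latticeConnectedCorr_smul, latticeConnectedCorr_zero_time] at h0
    simp only [Nat.cast_zero, mul_zero, neg_zero, Real.exp_zero, mul_one] at h0
    exact (le_abs_self _).trans h0
  set t : ℝ := |C| / v + 1 with ht
  have ht1 : 1 ≤ t := by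
    have : 0 ≤ |C| / v := div_nonneg (abs_nonneg C) hvar.le
    linarith
  have htv : t * v = |C| + v := by
    rw [ht, add_mul, one_mul, div_mul_cancel₀ _ hvar.ne']
  have hbig : |C| + v ≤ t * t * v := by
    calc |C| + v = 1 * (t * v) := by rw [htv, one_mul]
      _ ≤ t * (t * v) := mul_le_mul_of_nonneg_right ht1 (by rw [htv]; positivity)
      _ = t * t * v := by ring
  have := hle t
  linarith [le_abs_self C]

/-- Specialisation to compact simple `G` (non-abelian by definition of `IsSimpleCompactGroup`). [folklore] -/
theorem not_conclUniformC_of_simple (hG : IsCompactSimpleLieGroup G) (r : LatticeRep G) (a : ℝ → ℝ) :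
    ¬ ConclUniformC r a :=
  not_conclUniformC hG.1.2.1 r a

end UniformC

/-! ## §9 The socket and the repair -/

section Socket

variable {G : Type} [Group G] [TopologicalSpace G] [IsTopologicalGroup G] [CompactSpace G]
  [MeasurableSpace G] [BorelSpace G]

/-- **What the conclusion is consumed as** (the "socket" of `OSLegsFromFemtoAndGap`): `Concl r a` yields ONE rate
`c₁ > 0` such that every sequential scheme in the units `a` (`a_k = a(β_k)`) whose couplings eventually exceed `β₂`
and whose tori are eventually at least `S₁(β_k)` has the uniform lattice mass gap `HasLatticeMassGap r sch c₁` of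
the summit statement. So `Concl` IS the lattice half of the Clay mass gap along every scheme in units `a` — the
Millennium content in perturbative units, as the planner says. [folklore] -/
theorem hasLatticeMassGap_of_concl {ι : Type} (r : LatticeRep G) {a : ℝ → ℝ} (h : Concl r a) :
    ∃ (c₁ β₂ : ℝ) (S₁ : ℝ → ℕ), 0 < c₁ ∧ ∀ sch : SpeciesScheme ι, (∀ k, sch.a k = a (sch.β k)) →
      (∀ᶠ k in atTop, β₂ ≤ sch.β k) → (∀ᶠ k in atTop, S₁ (sch.β k) ≤ sch.L k) →
        HasLatticeMassGap r sch c₁ := by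
  obtain ⟨c₁, β₂, S₁, hc, h⟩ := h
  refine ⟨c₁, β₂, S₁, hc, fun sch ha hβ hL A B => ?_⟩
  obtain ⟨C, hC⟩ := h A B
  refine ⟨C, ?_⟩
  filter_upwards [hβ, hL] with k hk hkL S hS n hn
  rw [ha k, show c₁ * (a (sch.β k) * (n : ℝ)) = c₁ * a (sch.β k) * n by ring]
  exact hC (sch.β k) hk S n (hkL.trans hS) hn

end Socket

/-- **The repaired crux C′** (refuter's proposal; `refuted-misstated` classification IF a kill ever lands): the same
statement restricted to CONTINUOUS unit maps. For continuous `a` every level `s = n · a(β)` of the femto grid is met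
at unboundedly many couplings, so the two-sided bounds with ONE shape function pin `a` to the physical lattice
spacing up to constants (RG-improved femto perturbation theory), and C′ is the honest "mass gap `≥ c₁` in physical
units" — Clay-hard, believed true; the slow STEP unit maps that make the original statement physically false are
excluded. Inside the route `closes` applies the crux only to the unit map produced by `FemtoCurvatureTwoPoint`, so
restricting BOTH items to continuous unit maps costs the assembly nothing. [folklore] -/
def CruxRepaired : Prop :=
  ∀ (G : Type) [Group G] [TopologicalSpace G] [IsTopologicalGroup G] [CompactSpace G],
    IsCompactSimpleLieGroup G →
      letI : MeasurableSpace G := borel G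
      haveI : BorelSpace G := ⟨rfl⟩
      ∀ (r : LatticeRep G) (a : ℝ → ℝ), Continuous a → Package r a → Concl r a

/-- C′ is implied by the crux as filed (it only removes unit maps from the `∀`). [folklore] -/
theorem cruxRepaired_of_crux (h : LatticeGapInUVUnits) : CruxRepaired := by
  rw [crux_iff] at h
  intro G _ _ _ _ hG r a _ hP
  exact h G hG r a hP


/-! ## §10 (gen 2) The instance is available; the kill is exactly `H_UV ∧ H_IR` for one `SU(N)` -/

section Instance

/-- **The instance blocker is gone**: `SU(N)`, `N ≥ 2`, is a compact simple Lie group unconditionally (tree theorem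
`isSimpleCompactGroup_specialUnitaryGroup_holds` + `isCompactSimpleLieGroup_specialUnitaryGroup`). [folklore] -/
theorem isCompactSimpleLieGroup_su {N : ℕ} (hN : 2 ≤ N) :
    IsCompactSimpleLieGroup (Matrix.specialUnitaryGroup (Fin N) ℂ) :=
  isCompactSimpleLieGroup_specialUnitaryGroup isSimpleCompactGroup_specialUnitaryGroup_holds hN

/-- The fundamental lattice representation of `SU(N)`. [folklore] -/
def suFundD (N : ℕ) : LatticeRep (Matrix.specialUnitaryGroup (Fin N) ℂ) :=
  ⟨N, fundamentalRep (Fin N), continuous_fundamentalRep _, fundamentalRep_injective _,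
    fundamentalRep_mem_unitaryGroup⟩

/-- **Refutation template with a REAL group.** A single unit map carrying the femto package of `SU(N)` (fundamental
representation, Borel σ-algebra as in the crux) whose conclusion fails refutes the crux — no instance hypothesis
left. The negative lemma `latticeGapInUVUnits_false_of_standardScalingSU` (folder / `Negative/`) produces such an
`a` from `FixedTorusTwoSided (suFund N)` (the package, via `exists_slow_package`) and `XiDiverges (suFund N)`
(the failure of `Concl`). [folklore] -/
theorem not_crux_of_su_witness {N : ℕ} (hN : 2 ≤ N)
    (h : letI : MeasurableSpace (Matrix.specialUnitaryGroup (Fin N) ℂ) := borel _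
      haveI : BorelSpace (Matrix.specialUnitaryGroup (Fin N) ℂ) := ⟨rfl⟩
      ∃ a : ℝ → ℝ, Package (suFundD N) a ∧ ¬ Concl (suFundD N) a) :
    ¬ LatticeGapInUVUnits := by
  intro hcrux
  letI : MeasurableSpace (Matrix.specialUnitaryGroup (Fin N) ℂ) := borel _
  haveI : BorelSpace (Matrix.specialUnitaryGroup (Fin N) ℂ) := ⟨rfl⟩
  obtain ⟨a, hP, hC⟩ := h
  exact hC (crux_iff.1 hcrux _ (isCompactSimpleLieGroup_su hN) (suFundD N) a hP)

/-- **H_UV of the negative lemma, restated on this file's `BoxBounds` vocabulary** (equivalent, for thresholds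
`B(L) > 0`, to the `FixedTorusTwoSided` of `Negative/LatticeGapInUVUnitsFalseOfStandardScalingSU.lean`, which writes `c₀ ≤ β² n⁸ Cov ≤ C₀`):
the box bounds with unit map `1` and CONSTANT shape `β⁻²` on every fixed torus beyond an arbitrary threshold —
fixed-torus two-sided `β⁻²` plaquette asymptotics with side-uniform constants. Believed (lattice perturbation theory
on the femto torus, Lüscher 1983; zero-momentum modes, Coste et al. 1985), OPEN as a theorem. [folklore] -/
def FixedTorusTwoSidedD {G : Type} [Group G] [TopologicalSpace G] [IsTopologicalGroup G] [CompactSpace G]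
    [MeasurableSpace G] [BorelSpace G] (r : LatticeRep G) : Prop :=
  ∃ c₀ C₀ : ℝ, 0 < c₀ ∧ ∀ (L : ℕ) [NeZero L], ∃ B : ℝ, ∀ β : ℝ, B ≤ β →
    BoxBounds r (fun _ => 1) (fun _ => (β ^ 2)⁻¹) c₀ C₀ L β

/-- **H_IR of the negative lemma** (verbatim the `XiDiverges` of `Negative/LatticeGapInUVUnitsFalseOfStandardScalingSU.lean`):
the clustering rate of some pair of local observables on large tori is below some `m(β) → 0` — `ξ(β) → ∞`
(Chatterjee 1803.01950, Problem 5.1; OPEN). It is EXACTLY the negation-shape of `Concl` at rate `m`: compare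
`not_concl_of_xiDiverges_of_slow`. [folklore] -/
def XiDivergesD {G : Type} [Group G] [TopologicalSpace G] [IsTopologicalGroup G] [CompactSpace G]
    [MeasurableSpace G] [BorelSpace G] (r : LatticeRep G) : Prop :=
  ∃ (A B : YMSpecies G) (m : ℝ → ℝ) (β₁ : ℝ), Tendsto m atTop (𝓝 0) ∧
    ∀ β : ℝ, β₁ ≤ β → ∀ (S₀ : ℕ) (C : ℝ), ∃ S : ℕ, S₀ ≤ S ∧ ∃ n : ℕ, n ≤ S ∧
      C * Real.exp (-(m β * n)) < |latticeConnectedCorr r.ρ β (2 * S + 1) A.F B.F n|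

/-- **H_IR of the LANDED negative lemma (weak form)** (verbatim the `XiUnbounded` of
`Negative/LatticeGapInUVUnitsFalseOfStandardScalingSU.lean`): for every rate `ε > 0` there are arbitrarily large
couplings at which some fixed pair of local observables clusters more slowly than `e^{−ε n}` on large tori —
`limsup_β ξ(β) = ∞`. Weaker than `XiDivergesD` (`ξ → ∞`); still OPEN (Chatterjee 1803.01950, Problem 5.1). [folklore] -/
def XiUnboundedD {G : Type} [Group G] [TopologicalSpace G] [IsTopologicalGroup G] [CompactSpace G]
    [MeasurableSpace G] [BorelSpace G] (r : LatticeRep G) : Prop :=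
  ∃ A B : YMSpecies G, ∀ ε : ℝ, 0 < ε → ∀ b : ℝ, ∃ β : ℝ, b ≤ β ∧
    ∀ (S₀ : ℕ) (C : ℝ), ∃ S : ℕ, S₀ ≤ S ∧ ∃ n : ℕ, n ≤ S ∧
      C * Real.exp (-(ε * n)) < |latticeConnectedCorr r.ρ β (2 * S + 1) A.F B.F n|

/-- The strong form implies the weak form. [folklore] -/
theorem xiUnboundedD_of_xiDivergesD {G : Type} [Group G] [TopologicalSpace G] [IsTopologicalGroup G]
    [CompactSpace G] [MeasurableSpace G] [BorelSpace G] (r : LatticeRep G) (h : XiDivergesD r) :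
    XiUnboundedD r := by
  obtain ⟨A, B, m, β₁, hm, h⟩ := h
  refine ⟨A, B, fun ε hε b => ?_⟩
  have hev : ∀ᶠ β in atTop, m β < ε := hm (Iio_mem_nhds hε)
  obtain ⟨β, hβ, hmε⟩ := ((eventually_ge_atTop (max b β₁)).and hev).exists
  refine ⟨β, (le_max_left _ _).trans hβ, fun S₀ C => ?_⟩
  obtain ⟨S, hS, n, hn, hlt⟩ := h β ((le_max_right _ _).trans hβ) S₀ (max C 0)
  refine ⟨S, hS, n, hn, lt_of_le_of_lt ?_ hlt⟩
  have hn0 : (0 : ℝ) ≤ n := Nat.cast_nonneg n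
  calc C * Real.exp (-(ε * n)) ≤ max C 0 * Real.exp (-(ε * n)) :=
        mul_le_mul_of_nonneg_right (le_max_left _ _) (Real.exp_pos _).le
    _ ≤ max C 0 * Real.exp (-(m β * n)) := by
        refine mul_le_mul_of_nonneg_left (Real.exp_le_exp.2 ?_) (le_max_right _ _)
        nlinarith

/-- **The IR bookkeeping of the negative lemma**: if some unit map `a` sits above `√m` at every dyadic coupling
(`exists_slow_package` provides this for an ADMISSIBLE `a` under H_UV) and the pair `(A, B)` has clustering rate
`< m(β) → 0` on large tori, then `Concl r a` fails. [folklore] -/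
theorem not_concl_of_xiDiverges_of_slow {G : Type} [Group G] [TopologicalSpace G] [IsTopologicalGroup G]
    [CompactSpace G] [MeasurableSpace G] [BorelSpace G] (r : LatticeRep G) {a m : ℝ → ℝ}
    (hpos : ∀ β, 0 < a β) (hm : Tendsto m atTop (𝓝 0))
    (hslow : ∀ k : ℕ, Real.sqrt (m ((2 : ℝ) ^ k)) ≤ a ((2 : ℝ) ^ k))
    (hlowAB : ∃ (A B : YMSpecies G) (β₁ : ℝ), ∀ β : ℝ, β₁ ≤ β → ∀ (S₀ : ℕ) (C : ℝ), ∃ S : ℕ, S₀ ≤ S ∧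
      ∃ n : ℕ, n ≤ S ∧ C * Real.exp (-(m β * n)) < |latticeConnectedCorr r.ρ β (2 * S + 1) A.F B.F n|) :
    ¬ Concl r a := by
  rintro ⟨c₁, β₂, S₁, hc₁, hAB⟩
  obtain ⟨A, B, β₁, hlow⟩ := hlowAB
  obtain ⟨C₁, hC₁⟩ := hAB A B
  have h2 : Tendsto (fun k : ℕ => (2 : ℝ) ^ k) atTop atTop := tendsto_pow_atTop_atTop_of_one_lt one_lt_two
  have hev1 : ∀ᶠ k : ℕ in atTop, max β₁ β₂ ≤ (2 : ℝ) ^ k := h2.eventually_ge_atTop _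
  have hev2 : ∀ᶠ k : ℕ in atTop, m ((2 : ℝ) ^ k) < c₁ ^ 2 :=
    (hm.comp h2).eventually (Iio_mem_nhds (by positivity))
  obtain ⟨k, hk1, hk2⟩ := (hev1.and hev2).exists
  have hβ₁ : β₁ ≤ (2 : ℝ) ^ k := (le_max_left _ _).trans hk1
  have hβ₂ : β₂ ≤ (2 : ℝ) ^ k := (le_max_right _ _).trans hk1
  obtain ⟨S, hS, n, hn, hlt⟩ := hlow _ hβ₁ (S₁ ((2 : ℝ) ^ k)) (max C₁ 1)
  have hup := hC₁ _ hβ₂ S n hS hn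
  have hpos1 : (0 : ℝ) < max C₁ 1 := lt_max_of_lt_right one_pos
  have hchain : max C₁ 1 * Real.exp (-(m ((2 : ℝ) ^ k) * n)) <
      max C₁ 1 * Real.exp (-(c₁ * a ((2 : ℝ) ^ k) * n)) :=
    hlt.trans_le (hup.trans (mul_le_mul_of_nonneg_right (le_max_left _ _) (Real.exp_pos _).le))
  have hexp : Real.exp (-(m ((2 : ℝ) ^ k) * n)) < Real.exp (-(c₁ * a ((2 : ℝ) ^ k) * n)) :=
    lt_of_mul_lt_mul_left hchain hpos1.le
  rw [Real.exp_lt_exp] at hexp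
  have hn0 : (0 : ℝ) ≤ n := Nat.cast_nonneg n
  have hsq : Real.sqrt (m ((2 : ℝ) ^ k)) < c₁ := by
    rw [Real.sqrt_lt' hc₁]
    exact hk2
  have hmle : m ((2 : ℝ) ^ k) ≤ c₁ * a ((2 : ℝ) ^ k) := by
    rcases le_or_gt (m ((2 : ℝ) ^ k)) 0 with h0 | h0
    · exact h0.trans (mul_pos hc₁ (hpos _)).le
    · calc m ((2 : ℝ) ^ k) = Real.sqrt (m ((2 : ℝ) ^ k)) * Real.sqrt (m ((2 : ℝ) ^ k)) :=
            (Real.mul_self_sqrt h0.le).symm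
        _ ≤ c₁ * a ((2 : ℝ) ^ k) := mul_le_mul hsq.le (hslow k) (Real.sqrt_nonneg _) hc₁.le
  have : m ((2 : ℝ) ^ k) * n ≤ c₁ * a ((2 : ℝ) ^ k) * n := mul_le_mul_of_nonneg_right hmle hn0
  linarith

end Instance


/-! ## §11 (gen 2) Under the repair C′ = `Continuous a`, admissible rulers lie BELOW the bare-perturbative thresholds -/

section ContinuousRulers

variable {G : Type} [Group G] [TopologicalSpace G] [IsTopologicalGroup G] [CompactSpace G]
  [MeasurableSpace G] [BorelSpace G]

/-- **Continuous admissible rulers are pinned from the slow side by fixed-torus UPPER bounds.** Let `a` be a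
CONTINUOUS unit map carrying the femto package (the repaired crux C′), and suppose only the UPPER half of the
fixed-torus asymptotics: `β² · n⁸ · Cov_{β,L}(P_0^{01}, P_{ne₂}^{01}) ≤ C₀` for `β ≥ B(L)`, `1 ≤ n ≤ L/8` (thresholds
`B(L)` arbitrary). Then for every level `0 < s ≤ ℓ₀/8` there is `βm` such that for every `n ≥ 1` and every coupling
`β ≥ max(β₀, B(8n), βm)`: `a(β) < s/n`. In words: as soon as the torus of side `8n` is in its `β⁻²` regime at
coupling `β`, the ruler has already dropped below `s/n` — `a(β) ≤ 8 s / L_pert(β)` with `L_pert(β)` the largest side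
whose threshold is `≤ β` (physically `L_pert(β) ≈ e^{β/(8 N b₀)}`, i.e. `a ≲ a_phys^{1/2}`): the slowly decaying
rulers that kill the crux as typed (§10, `exists_slow_ruler`, which have `a(β) > 1/(L_pert(β) + 2)`) are impossible
under C′, for a PROVABLE reason and modulo upper bounds only. Proof: if `a(β) ≥ s/n` at such a `β`, continuity
and `a → 0` give `β' ≥ β` with `a(β') = s/n` (intermediate values); the box `L = 8n` is femto at `β'`
(`8n · a(β') = 8s ≤ ℓ₀`), so the package LOWER bound and the threshold UPPER bound give
`c Γ(s) ≤ n⁸ Cov ≤ C₀ / β'²`, i.e. `β' ≤ √(C₀/(c Γ(s)))`, impossible for `β > √(C₀/(c Γ(s)))`. So any proof of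
`FemtoCurvatureTwoPoint` under C′ must use couplings BELOW the bare-perturbative thresholds of its femto boxes:
dimensional transmutation is forced into the package, as the repair intends. [folklore] -/
theorem ruler_lt_of_continuous (r : LatticeRep G) {a Γ : ℝ → ℝ} {β₀ ℓ₀ c C : ℝ}
    (hP : PackageWith r a Γ β₀ ℓ₀ c C) (ha : Continuous a) {C₀ : ℝ} {B : ℕ → ℝ}
    (hB : ∀ (L : ℕ) [NeZero L] (β : ℝ), B L ≤ β → ∀ n : ℕ, 1 ≤ n → 8 * n ≤ L →
      β ^ 2 * ((n : ℝ) ^ 8 *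
        (wilsonExpectation (d := 4) (L := L) r.ρ β
            (fun U => ((r.N : ℝ) - (r.ρ (plaquetteHolonomy U 0 0 1)).trace.re) *
              ((r.N : ℝ) - (r.ρ (plaquetteHolonomy U (Pi.single (2 : Fin 4) ((n : ℕ) : ZMod L)) 0 1)).trace.re)) -
          wilsonExpectation (d := 4) (L := L) r.ρ β
              (fun U => (r.N : ℝ) - (r.ρ (plaquetteHolonomy U 0 0 1)).trace.re) *
            wilsonExpectation (d := 4) (L := L) r.ρ β
              (fun U => (r.N : ℝ) - (r.ρ (plaquetteHolonomy U (Pi.single (2 : Fin 4) ((n : ℕ) : ZMod L)) 0 1)).trace.re)))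
        ≤ C₀)
    {s : ℝ} (hs : 0 < s) (hsℓ : s ≤ ℓ₀ / 8) :
    ∃ βm : ℝ, ∀ n : ℕ, 1 ≤ n → ∀ β : ℝ, β₀ ≤ β → B (8 * n) ≤ β → βm ≤ β → a β < s / n := by
  obtain ⟨hℓ, hc, hpos, hlim, hΓ, hbox⟩ := hP
  have hsℓ' : s ≤ ℓ₀ := by linarith
  have hΓs : 0 < Γ s := (hΓ s hs hsℓ').1
  -- beyond `βm`, `C₀ / β² < c Γ(s)`
  set βm : ℝ := Real.sqrt (max C₀ 0 / (c * Γ s)) + 1 with hβm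
  refine ⟨βm, fun n hn β hβ₀ hBβ hβmβ => ?_⟩
  have hn0 : (0 : ℝ) < n := by exact_mod_cast hn
  by_contra hge
  push Not at hge
  -- a coupling `β' ≥ β` at which the ruler passes the level `s / n`
  obtain ⟨β', hββ', hlevel⟩ : ∃ β', β ≤ β' ∧ a β' = s / n := by
    have hev : ∀ᶠ x in atTop, a x < s / n := hlim (Iio_mem_nhds (div_pos hs hn0))
    obtain ⟨β₂, hβ₂ge, hβ₂lt⟩ := ((eventually_ge_atTop β).and hev).exists
    have hivt := intermediate_value_Icc' hβ₂ge ha.continuousOn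
    obtain ⟨β', hβ'mem, hβ'eq⟩ := hivt ⟨hβ₂lt.le, hge⟩
    exact ⟨β', hβ'mem.1, hβ'eq⟩
  have hβ'₀ : β₀ ≤ β' := hβ₀.trans hββ'
  have hβ'B : B (8 * n) ≤ β' := hBβ.trans hββ'
  have hβ'pos : 0 < β' := by
    have : (0 : ℝ) < βm := by rw [hβm]; positivity
    linarith [hβmβ.trans hββ']
  -- the box `L = 8 n` is femto at `β'`
  haveI : NeZero (8 * n) := ⟨by omega⟩
  have hfemto : ((8 * n : ℕ) : ℝ) * a β' ≤ ℓ₀ := by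
    rw [hlevel]; push_cast
    field_simp
    linarith
  obtain ⟨hax, -⟩ := hbox (8 * n) β' hβ'₀ hfemto
  have hlow := (hax n hn le_rfl).1
  have hup := hB (8 * n) β' hβ'B n hn le_rfl
  rw [hlevel, show (n : ℝ) * (s / n) = s by field_simp] at hlow
  -- `c Γ(s) ≤ n⁸ Cov ≤ C₀ / β'²`
  set X := (n : ℝ) ^ 8 *
    (wilsonExpectation (d := 4) (L := 8 * n) r.ρ β'
        (fun U => ((r.N : ℝ) - (r.ρ (plaquetteHolonomy U 0 0 1)).trace.re) *
          ((r.N : ℝ) - (r.ρ (plaquetteHolonomy U (Pi.single (2 : Fin 4) ((n : ℕ) : ZMod (8 * n))) 0 1)).trace.re)) -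
      wilsonExpectation (d := 4) (L := 8 * n) r.ρ β'
          (fun U => (r.N : ℝ) - (r.ρ (plaquetteHolonomy U 0 0 1)).trace.re) *
        wilsonExpectation (d := 4) (L := 8 * n) r.ρ β'
          (fun U => (r.N : ℝ) - (r.ρ (plaquetteHolonomy U (Pi.single (2 : Fin 4) ((n : ℕ) : ZMod (8 * n))) 0 1)).trace.re))
    with hX
  have h1 : c * Γ s ≤ X := hlow
  have h2 : β' ^ 2 * X ≤ C₀ := hup
  have hcΓ : 0 < c * Γ s := mul_pos hc hΓs
  have hβ'2 : 0 < β' ^ 2 := by positivity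
  have h3 : β' ^ 2 * (c * Γ s) ≤ max C₀ 0 :=
    (mul_le_mul_of_nonneg_left h1 hβ'2.le).trans (h2.trans (le_max_left _ _))
  have h4 : β' ^ 2 ≤ max C₀ 0 / (c * Γ s) := by rw [le_div_iff₀ hcΓ]; exact h3
  have h5 : β' ≤ Real.sqrt (max C₀ 0 / (c * Γ s)) := by
    rw [← Real.sqrt_sq hβ'pos.le]
    exact Real.sqrt_le_sqrt h4
  have h6 : βm ≤ β' := hβmβ.trans hββ'
  rw [hβm] at h6
  linarith

/-- **Non-vacuity of §11: continuous rulers DO pass every level at arbitrarily large couplings.** For a continuous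
unit map `a > 0`, `a → 0` and every level `s > 0`: for all large `n` there is a coupling `β ≥ β₀` with
`a(β) = s/n` (intermediate values between `β₀`, where eventually `a(β₀) > s/n`, and a coupling where `a < s/n`).
With `ruler_lt_of_continuous` these couplings all lie below `max(B(8n), βm)`: the femto-edge boxes of an honest
ruler are never bare-perturbative. [folklore] -/
theorem level_attained_of_continuous {a : ℝ → ℝ} (ha : Continuous a) (hpos : ∀ β, 0 < a β)
    (hlim : Tendsto a atTop (𝓝 0)) (β₀ : ℝ) {s : ℝ} (hs : 0 < s) :
    ∀ᶠ n : ℕ in atTop, ∃ β : ℝ, β₀ ≤ β ∧ a β = s / n := by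
  -- for `n > s / a β₀` the level `s / n` is below `a β₀`
  have hev : ∀ᶠ n : ℕ in atTop, s / a β₀ < n := tendsto_natCast_atTop_atTop.eventually_gt_atTop _
  filter_upwards [hev, eventually_ge_atTop 1] with n hn hn1
  have hn0 : (0 : ℝ) < n := by exact_mod_cast hn1
  have hlev : s / n < a β₀ := by
    rw [div_lt_iff₀ hn0]
    rw [div_lt_iff₀ (hpos β₀)] at hn
    linarith [mul_comm (a β₀) (n : ℝ)]
  have hev' : ∀ᶠ x in atTop, a x < s / n := hlim (Iio_mem_nhds (div_pos hs hn0))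
  obtain ⟨β₂, hβ₂ge, hβ₂lt⟩ := ((eventually_ge_atTop β₀).and hev').exists
  obtain ⟨β, hβmem, hβeq⟩ := intermediate_value_Icc' hβ₂ge ha.continuousOn ⟨hβ₂lt.le, hlev.le⟩
  exact ⟨β, hβmem.1, hβeq⟩

end ContinuousRulers

end

end Summit.QuantumFields.YangMills.Cruxes.LatticeGapInUVUnits.Disproof
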